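import Summits.AtomisticToContinuum.FouriersLaw.Theses.BondHeatUncertainty
import Summits.AtomisticToContinuum.FouriersLaw.Theorems.ExtensiveSnapshotIrreversibility.Negative.LoadBearingHypotheses
import Summits.AtomisticToContinuum.FouriersLaw.Theorems.ExtensiveSnapshotIrreversibility.Negative.DegenerateInstances
import Summits.AtomisticToContinuum.FouriersLaw.Theorems.BondHeatUncertaintyExtensiveSnapshotIrreversibilityKernelFacts
import Summits.AtomisticToContinuum.FouriersLaw.Theorems.BondHeatUncertaintyExtensiveSnapshotIrreversibilityCorrectorIntegrability
import Summits.AtomisticToContinuum.FouriersLaw.Theorems.BondHeatUncertaintyExtensiveSnapshotIrreversibilityCorrectorCocycle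
import Summits.AtomisticToContinuum.FouriersLaw.Theorems.BondHeatUncertaintyExtensiveSnapshotIrreversibilityGibbsContactCalculus
import Summits.AtomisticToContinuum.FouriersLaw.Theorems.BondHeatUncertaintyExtensiveSnapshotIrreversibilityClausiusBudget
import Summits.AtomisticToContinuum.FouriersLaw.Theorems.BondHeatUncertaintyExtensiveSnapshotIrreversibilityMcLennanIdentification
import Summits.AtomisticToContinuum.FouriersLaw.Theorems.BondHeatUncertaintyExtensiveSnapshotIrreversibilitySnapshotKLUpperReduction
import Summits.AtomisticToContinuum.FouriersLaw.Theorems.BondHeatUncertaintyExtensiveSnapshotIrreversibilityResponseDensity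
import Summits.AtomisticToContinuum.FouriersLaw.Theorems.BondHeatUncertaintyExtensiveSnapshotIrreversibilityLateOddResponseOfFisher
import Summits.AtomisticToContinuum.FouriersLaw.Theorems.BondHeatUncertaintyExtensiveSnapshotIrreversibilityCorrectorHeatSplit
import Summits.AtomisticToContinuum.FouriersLaw.Theorems.BondHeatUncertaintyExtensiveSnapshotIrreversibilityOddLogDensityOfRegularity
import Summits.AtomisticToContinuum.FouriersLaw.Theorems.BondHeatUncertaintyExtensiveSnapshotIrreversibilityOddLogDensityOfOddRegularity
import Summits.AtomisticToContinuum.FouriersLaw.Theorems.BondHeatUncertaintyExtensiveSnapshotIrreversibilityOddCorrectorOfKuboCorrector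
import Summits.AtomisticToContinuum.FouriersLaw.Theorems.BondHeatUncertaintyExtensiveSnapshotIrreversibilityTotalGreenKuboCap
import Summits.AtomisticToContinuum.FouriersLaw.Theorems.BondHeatUncertaintyExtensiveSnapshotIrreversibilityTapDualityOddCorrector

/-!
# Line `tap-duality-gk-time` — strategist's ALTERNATIVE skeleton for the crux
`BondHeatUncertainty.ExtensiveSnapshotIrreversibility` (item stmt-AtomisticToContinuum-9121)

Crux-strategist planner-cstrat-stmt-AtomisticToContinuum-9121-s1-0, 2026-08-17.  Registered with `--alt` semantics: it does NOT
replace the lead's live skeleton `Lines/clausius_budget_sound_window.lean` (v10); it REUSES v10's kernel-checked composition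
(K) ⟸ S1r' `stub_oddLogDensityRegularity` (fixed `N`) ∧ S4k `stub_kuboCorrectorOddCubicBound` (`N`-uniform), with all of
v10's landed pieces cited BY NAME, and changes exactly one thing: the `N`-uniform stub S4k (`∫ (u − u∘Θ)² dμ_T ≤ C·N³` for the
Kubo corrector `u` of `J_tot`, judged CRUX-SIZED by four leads) is no longer a stub but is DERIVED from three new stubs

* S_A `stub_tapDualityOddCorrector` (fixed `N`, size L, provable from the sibling route's landed corrector calculus):
  the TAP-DUALITY INEQUALITY `(∫ (u⁻)² dμ_T)² ≤ ⟨u, J⟩_{μ_T} · GK(u⁻)`, where `u⁻ = ½(u − u∘Θ)` and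
  `GK(u⁻) = ∫₀^∞ ⟨u⁻, P_t u⁻⟩_{μ_T} dt` is the Green–Kubo integral (integrated autocorrelation) of `u⁻` itself
  (the statement carries the absolute convergence of that integral).  WHY TRUE: the parity split of `L u = −J`
  (`L = A + S`, `A` the Liouvillian, `S = γ Σ_b 𝒩_b` the two Ornstein–Uhlenbeck taps; even part `A u⁻ + S u⁺ = 0`,
  CorrectorTheory (7)) gives `−L u⁻ = S(u∘Θ)`: THE ODD CORRECTOR IS THE GREEN IMAGE OF A TAP-SUPPORTED SOURCE.  Pair with
  any `φ`: `⟨u⁻, φ⟩ = ⟨S(u∘Θ), G†φ⟩ = −γT Σ_b ⟨∂_{p_b}(u∘Θ), ∂_{p_b} G†φ⟩`, and Cauchy–Schwarz lands on the two TAP ENERGY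
  IDENTITIES `γT Σ_b ‖∂_{p_b} u‖² = ⟨u, J⟩` (CorrectorTheory (6)) and `γT Σ_b ‖∂_{p_b} G†φ‖² = ⟨φ, Gφ⟩`; take `φ = u⁻`.
* S_B `stub_totalGreenKuboCap` (`N`-uniform constant but provable now, size M): `0 ≤ ⟨u, J⟩_{μ_T} ≤ γ T² (N−1)²` — an
  EQUILIBRIUM proof of the conductance cap `G_N ≤ γ` (`γ/2` with reflection symmetry): bond sum rule
  `⟨u, J⟩ = (N−1)⟨u, j_0⟩` (CorrectorTheory (5)), contact-bond identity `⟨u, j_0⟩ = ⟨u, f_L⟩ = γ⟨u, p_0² − T⟩`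
  (site-0 energy balance `−L e_0 = j_0 + f_L`, `−L = −L† − 2A`, `A e_0 = −j_0`, `⟨J, e_0⟩ = 0`), Gaussian integration by
  parts `⟨u, p_0² − T⟩ = T⟨∂_{p_0}u, p_0⟩` and the tap energy identity (6).  Exactly reproduced at the harmonic corner
  (`⟨u, j_i⟩ = ⟨u, f_L⟩ = T²D_N` to all digits).
* S_C `stub_oddCorrectorGreenKuboTime` (`N`-UNIFORM, HARDEST, the line's residual): `GK(u⁻) ≤ C·N·∫(u⁻)² dμ_T` — the
  Green–Kubo (integrated-autocorrelation) TIME of the single observable `u⁻` is at most BALLISTIC.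

Composition (sorry-free, `kuboCorrectorOddCubicBound_of_tapDuality`): `a := ∫(u⁻)²`, `a² ≤ ⟨u,J⟩·GK ≤ γT²(N−1)²·max(C,0)·N·a`,
hence `∫(u − u∘Θ)² = 4a ≤ 4γT² max(C,0)·N³` = S4k verbatim; then v10's landed chain S4k → S4o → S4 → (K) with S1r'.

WHY THIS RESHAPES THE STUCK GOAL.  Every registered line funnels into an `L²` NORM bound on the odd corrector (S4o/S4k/S4f) or a
gradient bound (momentum-fisher) — and the only tools that bound `‖G f‖` are spectral-gap / resolvent / hypocoercive RATES
(false-shaped: `τ_N ≍ N³` harmonic, `≳ N²` diffusive; c4 Identity A needs `τ_N ≤ CN`).  The tap representation moves the whole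
`N`-uniform content into `⟨u,J⟩ × GK(u⁻)`: the first factor is capped for free (S_B), and the residual is a Green–Kubo-TYPE
quantity of ONE observable at the BALLISTIC scale `N` — true-shaped in BOTH regimes (ballistic transit / one causal crossing),
tolerant of the norm persistence that killed `OddCorrectorDecay` (an `L²(μ_T)`-unitary bulk keeps ‖P_t u⁻‖ for `t ≲ N/2` but the
transport forecast of every phonon ALTERNATES IN SIGN at each reflection, so the INTEGRATED autocorrelation stays `≍ N‖u⁻‖²`:
cancellation, not decay), and open to Green–Kubo technology (Komorowski–Landim–Olla variational formula
`⟨φ,(−L)⁻¹φ⟩ = inf_χ {‖φ + Aχ‖²_{−1,S} + ‖χ‖²_{1,S}}` with closed-flow test functions, asymptotic-variance bounds).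
CHEAPEST FALSIFIER RUN (exact Gaussian algebra at the harmonic corner, kit j022073, `N ≤ 256`, nine `(ω₂,γ,T)` points,
`Cruxes/…/` evidence `RESULTS.md`): `τ(u⁻)/N := GK(u⁻)/(N∫(u⁻)²)` CONVERGES (0.68 at (1,1,1); 0.195…1.36 over the scan; slow
at γ = 0.05), and S_A is 94–100 % SATURATED for γ ≥ 0.7 (ratio `(∫(u⁻)²)²/(⟨u,J⟩GK) → 0.980` at (1,1,1), `= 1.0000` at γ = 5):
the line loses NOTHING at the corner where S4k is order-tight (`∫(u − u∘Θ)² = 2(N−1)²T⁴K_N ≈ N³/3`).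
Relation to the sibling crux E1 `ConeScaleCorrector` (stmt-14069, `∫u² ≤ C N²·Z`): by S_A–S_B, E1's ODD half follows from
S_C with the diffusive value `⟨u,J⟩ ≍ N` (`D_N = O(1)`), i.e. S_C is the odd sector "at true scale" automatically; the even half
of E1 is not needed by (K).

Disproof.lean (cdisprove cycles 1–3, NO KILL) honoured as in v10: family hypothesis used (S1, `N = 0,1` glue), `0 < T`
everywhere (`false_without_Tpos`; `T⁻²`-type constants), eventual-in-`δ` only (`false_withAllDelta`), `C·N` never `o(N)`
(the harmonic corner's `K_N = N/6 − 2/9` is carried by S_C's constant `≈ 0.68·N`), no stub is a norm-DECAY statement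
(`oddCorrectorDecay_false_of_oddSectorLocalityHypothesis`), S_B's cap is the equilibrium twin of the landed contact anchor
`γT³(ι_0 + ι_{N−1}) = γ/2 − G_N ≥ 0`.  Registered stubs (4): S1r' `stub_oddLogDensityRegularity` (shared with v10, fixed `N`),
S_A `stub_tapDualityOddCorrector`, S_B `stub_totalGreenKuboCap`, S_C `stub_oddCorrectorGreenKuboTime` (hardest).
Everything else below is v10 verbatim (landed pieces by name; glue `concl_of_parts`, `ExtensiveSnapshotIrreversibility_of`).
-/

noncomputable section

namespace Summit.AtomisticToContinuum.FouriersLaw.Cruxes.ExtensiveSnapshotIrreversibility.TapDualityGkTime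

open MeasureTheory Filter Topology InformationTheory
open scoped ENNReal NNReal
open Literature.MathematicalPhysics.KineticTheory.HeatConduction
open Summit.AtomisticToContinuum.FouriersLaw.Theses.BondHeatUncertainty
open Summit.AtomisticToContinuum.FouriersLaw.Theorems.ExtensiveSnapshotIrreversibility.Negative

/-! ## Stubs (`sorry` only here)

Common `let`-dictionary inside the signatures (for `P = pinnedChain ω₂ lam β γ`, `N ≥ 2`, `T > 0`):
`μT := P.gibbsMeasure N T`; `g y := γ/(2T²)·(p_0² − p_{N−1}²)` (the SOURCE); `Pg s z := ∫ g d(P.transitionKernel N T T s z)`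
(`s : ℝ`, read through `Real.toNNReal`); `k τ z := ∫₀^τ Pg s z ds` (WINDOW RESPONSE); `w z := ∫_{s>0} Pg s z ds` (McLENNAN
CORRECTOR, improper Bochner integral); `Pw τ z := ∫ w d(P.transitionKernel N T T τ z)` (evolved corrector); flip `Θ z = (z.1, −z.2)`.
Hypothesis blocks: (INV) `∀ t, μT.bind (P.transitionKernel N T T t) = μT`; (MIX) CEHR (2.5) at equilibrium:
`∀ ϑ ∈ (0, 1/T) ∃ C c > 0 ∀ z t f`, `f` continuous with `|f| ≤ e^{ϑH}` ⇒ `|P_t f(z) − μT(f)| ≤ C e^{ϑH(z)} e^{−ct}`. -/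

/-- **S0 `stub_equilibriumKernelFacts`** (fixed `N ≥ 1`, size M, provable from the tree). Under weak-NESS uniqueness,
for `T > 0`: (INV) the Gibbs measure at `T` is invariant for the constructed equilibrium kernels `transitionKernel N T T t`,
and (MIX) the equilibrium semigroup converges exponentially to `μ_T(f)` in the `e^{ϑH}`-weighted norm for every
`0 < ϑ < 1/T`. Proof route: `pinnedChainSemigroup_exists_isInvariant CuneoEckmannHairerReyBellet2018_H2_holds` gives a
Krylov–Bogoliubov invariant probability measure `μ⋆` of `pinnedChainSemigroup` (kernels = `transitionKernel`, simp lemma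
`pinnedChainSemigroup_kernel`); `LangevinChainSemigroup.IsInvariant.isSteadyState` makes it a weak steady state at
`(T, T)`; the guard and `pinnedChain_isSteadyState_gibbsMeasure` give `μ⋆ = gibbsMeasure N T`; (MIX) is
`pinnedChainSemigroup_exp_convergence` with `h36 := pinnedChain_minorization_of_localSmall … pinnedChain_localSmall`
(`max T T = T`). -/
theorem stub_equilibriumKernelFacts :
    ∀ ω₂ lam β γ : ℝ, 0 < ω₂ → 0 < lam → 0 < β → 0 < γ →
      (∀ (N : ℕ) (T_L T_R : ℝ), 0 < T_L → 0 < T_R → ∀ μ ν : Measure (PhaseSpace N),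
        (pinnedChain ω₂ lam β γ).IsSteadyState N T_L T_R μ →
        (pinnedChain ω₂ lam β γ).IsSteadyState N T_L T_R ν → μ = ν) →
      ∀ T : ℝ, 0 < T → ∀ N : ℕ, 0 < N →
        let P := pinnedChain ω₂ lam β γ
        let μT := P.gibbsMeasure N T
        (∀ t : ℝ≥0, μT.bind (P.transitionKernel N T T t) = μT) ∧
        (∀ ϑ : ℝ, 0 < ϑ → ϑ < 1 / T → ∃ C c : ℝ, 0 < C ∧ 0 < c ∧
          ∀ (z : PhaseSpace N) (t : ℝ≥0) (f : PhaseSpace N → ℝ), Continuous f →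
            (∀ y, |f y| ≤ Real.exp (ϑ * P.hamiltonian N y)) →
            |(∫ y, f y ∂(P.transitionKernel N T T t z)) - ∫ y, f y ∂μT| ≤
              C * Real.exp (ϑ * P.hamiltonian N z) * Real.exp (-c * t)) :=
  -- LANDED (p77081): Theorems/BondHeatUncertaintyExtensiveSnapshotIrreversibilityKernelFacts.lean
  Summit.AtomisticToContinuum.FouriersLaw.Theorems.ExtensiveSnapshotIrreversibility.ClausiusBudget.stub_equilibriumKernelFacts

/-- **S1a `stub_mcLennanIdentification`** (fixed `N ≥ 2`, size L, PROVABLE NOW modulo assembling — reshaped 2026-08-16 from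
the blocked S1). Under the guard, along a steady-state family, for `T > 0`, `N ≥ 2`, given (INV), (MIX) and `w ∈ L²(μ_T)`:
EVERY `L²` linear-response density `h` of `δ ↦ μ_{N,T+δ/2,T−δ/2}` at `δ = 0` (the interface of the sibling item
`OddSectorIrreversibility.ResponseDensity`, verbatim) has the same reversal asymmetry as the McLennan corrector:
`∫ (h − h∘Θ)² d(μ N T T) = ∫ (w − w∘Θ)² dμ_T` (indeed `h = w∘Θ` a.e.; McLennan / MaesNetocny2010). Route: `μ N T T = μ_T`
(guard + `pinnedChain_isSteadyState_gibbsMeasure`); the weak adjoint equation `∫ (L_T F) h dμ_T = −∫ F g dμ_T` for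
`F ∈ C_c^∞` is PROVED in tree (`…Theorems.OddSectorIrreversibility.integral_generator_mul_responseDensity_gibbs`, p79055);
`w` is a weak solution of `L_T k = −g` and kernel detailed balance `P_s† = ΘP_sΘ` on `L²(μ_T)` follows from the essential
m-dissipativity of `(L, C_c^∞)` in `L²(μ_T)` (density of `Range(1−L)C_c^∞`:
`OddSectorIrreversibility.exists_testFunction_resolvent_approx`, landed, used by S3b) plus the static identity
`∫ G (L F) dμ_T = ∫ (ΘLΘ G) F dμ_T`; weak `L²` solutions of `L_T†k = 0` are a.e. constant ((MIX) + the same core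
property), whence `h − w∘Θ` is a.e. constant and the odd parts agree. -/
theorem stub_mcLennanIdentification :
    ∀ ω₂ lam β γ : ℝ, 0 < ω₂ → 0 < lam → 0 < β → 0 < γ →
      (∀ (N : ℕ) (T_L T_R : ℝ), 0 < T_L → 0 < T_R → ∀ μ ν : Measure (PhaseSpace N),
        (pinnedChain ω₂ lam β γ).IsSteadyState N T_L T_R μ →
        (pinnedChain ω₂ lam β γ).IsSteadyState N T_L T_R ν → μ = ν) →
      ∀ μ : (N : ℕ) → ℝ → ℝ → Measure (PhaseSpace N),
        (∀ (N : ℕ) (T_L T_R : ℝ), 0 < T_L → 0 < T_R →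
          (pinnedChain ω₂ lam β γ).IsSteadyState N T_L T_R (μ N T_L T_R)) →
        ∀ T : ℝ, 0 < T → ∀ (N : ℕ) (hN : 2 ≤ N),
          let P := pinnedChain ω₂ lam β γ
          let μT := P.gibbsMeasure N T
          (∀ t : ℝ≥0, μT.bind (P.transitionKernel N T T t) = μT) →
          (∀ ϑ : ℝ, 0 < ϑ → ϑ < 1 / T → ∃ C c : ℝ, 0 < C ∧ 0 < c ∧
            ∀ (z : PhaseSpace N) (t : ℝ≥0) (f : PhaseSpace N → ℝ), Continuous f →
              (∀ y, |f y| ≤ Real.exp (ϑ * P.hamiltonian N y)) →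
              |(∫ y, f y ∂(P.transitionKernel N T T t z)) - ∫ y, f y ∂μT| ≤
                C * Real.exp (ϑ * P.hamiltonian N z) * Real.exp (-c * t)) →
          let g : PhaseSpace N → ℝ := fun y =>
            γ / (2 * T ^ 2) * (y.2 ⟨0, by omega⟩ ^ 2 - y.2 ⟨N - 1, by omega⟩ ^ 2)
          let Pg : ℝ → PhaseSpace N → ℝ := fun s z => ∫ y, g y ∂(P.transitionKernel N T T s.toNNReal z)
          let w : PhaseSpace N → ℝ := fun z => ∫ s in Set.Ioi (0 : ℝ), Pg s z
          MemLp w 2 μT →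
          ∀ h : PhaseSpace N → ℝ,
            (MemLp h 2 (μ N T T) ∧
              (∀ F : PhaseSpace N → ℝ, ContDiff ℝ ((⊤ : ℕ∞) : WithTop ℕ∞) F → HasCompactSupport F →
                Tendsto (fun δ : ℝ => ((∫ x, F x ∂(μ N (T + δ / 2) (T - δ / 2))) - ∫ x, F x ∂(μ N T T)) / δ)
                  (𝓝[≠] (0 : ℝ)) (𝓝 (∫ x, F x * h x ∂(μ N T T)))) ∧
              (∀ i : Fin N, Tendsto (fun δ : ℝ =>
                  ((∫ x, (pinnedChain ω₂ lam β γ).bondCurrent N i x ∂(μ N (T + δ / 2) (T - δ / 2))) -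
                    ∫ x, (pinnedChain ω₂ lam β γ).bondCurrent N i x ∂(μ N T T)) / δ)
                  (𝓝[≠] (0 : ℝ)) (𝓝 (∫ x, (pinnedChain ω₂ lam β γ).bondCurrent N i x * h x ∂(μ N T T))))) →
            ∫ x, (h x - h (x.1, -x.2)) ^ 2 ∂(μ N T T) = ∫ z, (w z - w (z.1, -z.2)) ^ 2 ∂μT :=
  -- LANDED (p91177): Theorems/BondHeatUncertaintyExtensiveSnapshotIrreversibilityMcLennanIdentification.lean
  Summit.AtomisticToContinuum.FouriersLaw.Theorems.ExtensiveSnapshotIrreversibility.ClausiusBudget.stub_mcLennanIdentification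

/-- **S1b `stub_responseDensity`** (fixed `N`, size L) — VERBATIM the statement of the sibling route item
`OddSectorIrreversibility.ResponseDensity` (stmt-AtomisticToContinuum-9144, OPEN, has its own prover seat; stated as text, not by
name, so that this skeleton does not import a route file under edit): under the
guard, along every steady-state family, for `T > 0` and every `N`, a linear-response density `h ∈ L²(μ N T T)` of
`δ ↦ μ_{N,T+δ/2,T−δ/2}` at `δ = 0` exists (weak derivative tested on `C_c^∞` observables and on the bond currents). When that
item closes, the gate appends `ResponseDensity_holds` to its route file and this stub is discharged by a three-line file
importing it; no worker of this line duplicates that seat. -/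
theorem stub_responseDensity :
    ∀ ω₂ lam β γ : ℝ, 0 < ω₂ → 0 < lam → 0 < β → 0 < γ →
      (∀ (N : ℕ) (T_L T_R : ℝ), 0 < T_L → 0 < T_R → ∀ μ ν : Measure (PhaseSpace N),
        (pinnedChain ω₂ lam β γ).IsSteadyState N T_L T_R μ →
        (pinnedChain ω₂ lam β γ).IsSteadyState N T_L T_R ν → μ = ν) →
      ∀ μ : (N : ℕ) → ℝ → ℝ → Measure (PhaseSpace N),
        (∀ (N : ℕ) (T_L T_R : ℝ), 0 < T_L → 0 < T_R →
          (pinnedChain ω₂ lam β γ).IsSteadyState N T_L T_R (μ N T_L T_R)) →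
        ∀ T : ℝ, 0 < T → ∀ N : ℕ,
          ∃ h : PhaseSpace N → ℝ,
            (MemLp h 2 (μ N T T) ∧
              (∀ F : PhaseSpace N → ℝ, ContDiff ℝ ((⊤ : ℕ∞) : WithTop ℕ∞) F → HasCompactSupport F →
                Tendsto (fun δ : ℝ => ((∫ x, F x ∂(μ N (T + δ / 2) (T - δ / 2))) - ∫ x, F x ∂(μ N T T)) / δ)
                  (𝓝[≠] (0 : ℝ)) (𝓝 (∫ x, F x * h x ∂(μ N T T)))) ∧
              (∀ i : Fin N, Tendsto (fun δ : ℝ =>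
                  ((∫ x, (pinnedChain ω₂ lam β γ).bondCurrent N i x ∂(μ N (T + δ / 2) (T - δ / 2))) -
                    ∫ x, (pinnedChain ω₂ lam β γ).bondCurrent N i x ∂(μ N T T)) / δ)
                  (𝓝[≠] (0 : ℝ)) (𝓝 (∫ x, (pinnedChain ω₂ lam β γ).bondCurrent N i x * h x ∂(μ N T T))))) :=
  -- DISCHARGED (p95551) by the sibling item stmt-9144, proved 2026-08-16 (…OddSectorIrreversibility.Corrector.responseDensity_holds)
  Summit.AtomisticToContinuum.FouriersLaw.Theorems.ExtensiveSnapshotIrreversibility.ClausiusBudget.stub_responseDensity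

/-- **S1r' `stub_oddLogDensityRegularity`** (fixed `N ≥ 2`; reshaped by the c2 lead 2026-08-16 from S1r — THE unprinted
fixed-`N` analytic debt, WEAKENED: two-sided control is asked only of the ODD part of the NESS log-density). Under the guard, along
every steady-state family, for `T > 0`, `N ≥ 2`: for `δ ≠ 0` small the steady state is the Gibbs state at `T` reweighted by `e^{φ_δ}`
(clause (R1): positive density — LANDED ingredients p115843 + p105925), with (R2u) an UPPER Gibbs-type bound `φ_δ ≤ η(1 + H)` uniform
in small `δ` (`η < 1/(4T)`; pointwise hypoelliptic `L¹ → L^∞` estimate with polynomial constants + the landed uniform exponential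
moments `ness_uniform_exp_moment`), (R0) pointwise continuity `φ_δ(x) → 0` as `δ → 0` (local uniform convergence of the NESS
densities to the Gibbs density: equicontinuity + the weak continuity `ness_tendsto_gibbsMeasure`), (R3o) a two-sided
Lipschitz-in-`δ` bound with polynomial weight for the ODD part only, `|φ_δ − φ_δ∘Θ| ≤ C|δ|(1 + H)^k`, and (R4o) pointwise
differentiability of the odd part at `δ = 0`: `(φ_δ − φ_δ∘Θ)(x)/δ → d₀(x)` for a measurable `d₀`. No lower bound on the density
relative to Gibbs is asked any more (the v7 clause `|φ_δ| ≤ η(1+H)` and the two-sided `|φ_δ| ≤ C|δ|(1+H)^k` are gone): what stays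
two-sided is `d_δ = log ρ_δ − log ρ_δ∘Θ`, the log-odds of a state against its momentum reversal, `≈ δ·`(directional energy
content)`/T²`. S1d follows from it by dominated convergence (`stub_oddLogDensity_of_oddRegularity`). Not in print
(MaesNetocny2010 Thm 3.1 is conditional on smooth density dependence; EckmannPilletReyBellet1999a is one-sided in a Gibbs-weighted `L²`). -/
theorem stub_oddLogDensityRegularity :
    ∀ ω₂ lam β γ : ℝ, 0 < ω₂ → 0 < lam → 0 < β → 0 < γ →
      (∀ (N : ℕ) (T_L T_R : ℝ), 0 < T_L → 0 < T_R → ∀ μ ν : Measure (PhaseSpace N),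
        (pinnedChain ω₂ lam β γ).IsSteadyState N T_L T_R μ →
        (pinnedChain ω₂ lam β γ).IsSteadyState N T_L T_R ν → μ = ν) →
      ∀ μ : (N : ℕ) → ℝ → ℝ → Measure (PhaseSpace N),
        (∀ (N : ℕ) (T_L T_R : ℝ), 0 < T_L → 0 < T_R →
          (pinnedChain ω₂ lam β γ).IsSteadyState N T_L T_R (μ N T_L T_R)) →
        ∀ T : ℝ, 0 < T → ∀ N : ℕ, 2 ≤ N →
          ∃ δ₀ η C : ℝ, ∃ k : ℕ, 0 < δ₀ ∧ 0 < η ∧ η < 1 / (4 * T) ∧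
          ∃ φ : ℝ → PhaseSpace N → ℝ, ∃ d₀ : PhaseSpace N → ℝ,
            (∀ δ : ℝ, Measurable (φ δ)) ∧ Measurable d₀ ∧
            (∀ δ : ℝ, δ ≠ 0 → |δ| < δ₀ →
              μ N (T + δ / 2) (T - δ / 2) =
                ((pinnedChain ω₂ lam β γ).gibbsMeasure N T).withDensity
                  (fun x => ENNReal.ofReal (Real.exp (φ δ x)))) ∧
            (∀ δ : ℝ, |δ| < δ₀ → ∀ x : PhaseSpace N,
              φ δ x ≤ η * (1 + (pinnedChain ω₂ lam β γ).hamiltonian N x)) ∧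
            (∀ x : PhaseSpace N, Tendsto (fun δ : ℝ => φ δ x) (𝓝[≠] (0 : ℝ)) (𝓝 0)) ∧
            (∀ δ : ℝ, |δ| < δ₀ → ∀ x : PhaseSpace N,
              |φ δ x - φ δ (x.1, -x.2)| ≤
                C * |δ| * (1 + (pinnedChain ω₂ lam β γ).hamiltonian N x) ^ k) ∧
            (∀ x : PhaseSpace N,
              Tendsto (fun δ : ℝ => (φ δ x - φ δ (x.1, -x.2)) / δ) (𝓝[≠] (0 : ℝ)) (𝓝 (d₀ x))) := by
  sorry

/-- **S1g' `stub_oddLogDensity_of_oddRegularity`** (fixed `N ≥ 2`, size L, PROVABLE NOW: dominated convergence, same tools as the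
landed S1g p103202 minus the McLennan identification). The odd-regularity statement S1r' implies S1d verbatim: on `0 < |δ| < δ₀` put
`ρ_δ := e^{φ_δ} · e^{-H/T}/Z` (positive, measurable; `gibbsMeasure = volume.withDensity (gibbsDensity/Z)`), so
`log ρ_δ − log ρ_δ∘Θ = φ_δ − φ_δ∘Θ` (`H` is even in the momenta, `hamiltonian_neg_momentum`); by (R3o)+(R4o) and (R2u)+(R0),
`δ⁻²∫(φ_δ − φ_δ∘Θ)² e^{φ_δ} dμ_T → ∫ d₀² dμ_T` (integrand `→ d₀²·e⁰` pointwise; dominated by `C²(1+H)^{2k} e^{η(1+H)} ∈ L¹(μ_T)`,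
`pinnedChain_integrable_exp_mul_hamiltonian_gibbsMeasure`). IDENTIFICATION of `d₀` with the odd part of the GIVEN response density
`h`: for `F ∈ C_c^∞`, testing the response hypothesis on `F` and `F∘Θ` gives `δ⁻¹∫ F (e^{φ_δ} − e^{φ_δ∘Θ}) dμ_T → ∫ F (h − h∘Θ) dμ_T`
(`μ N T T = μ_T` by the guard + `pinnedChain_isSteadyState_gibbsMeasure`; flip-invariance of `μ_T`, `gibbsMeasure_map_flip`), while
pointwise `δ⁻¹(e^{φ_δ} − e^{φ_δ∘Θ}) = e^{φ_δ∘Θ}(e^{φ_δ−φ_δ∘Θ} − 1)/δ → d₀` with the domination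
`|e^a − e^b| ≤ e^{max(a,b)}|a − b| ≤ e^{η(1+H)} C(1+H)^k` ((R2u) at `x` and `Θx`, (R3o)) — no lower bound needed; hence
`∫ F d₀ dμ_T = ∫ F (h − h∘Θ) dμ_T` for all `F ∈ C_c^∞`, `d₀ = h − h∘Θ` `μ_T`-a.e. (`OddLogDensity.ae_eq_of_tendsto_testFunction`,
landed), so `∫ d₀² dμ_T = ∫ (h − h∘Θ)² dμ_{N,T,T} < D` and the bound `≤ Dδ²` holds eventually; integrability of
`(log ρ_δ − log ρ_δ∘Θ)²` under `μ_δ` is the same domination. -/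
theorem stub_oddLogDensity_of_oddRegularity :
    (∀ ω₂ lam β γ : ℝ, 0 < ω₂ → 0 < lam → 0 < β → 0 < γ →
      (∀ (N : ℕ) (T_L T_R : ℝ), 0 < T_L → 0 < T_R → ∀ μ ν : Measure (PhaseSpace N),
        (pinnedChain ω₂ lam β γ).IsSteadyState N T_L T_R μ →
        (pinnedChain ω₂ lam β γ).IsSteadyState N T_L T_R ν → μ = ν) →
      ∀ μ : (N : ℕ) → ℝ → ℝ → Measure (PhaseSpace N),
        (∀ (N : ℕ) (T_L T_R : ℝ), 0 < T_L → 0 < T_R →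
          (pinnedChain ω₂ lam β γ).IsSteadyState N T_L T_R (μ N T_L T_R)) →
        ∀ T : ℝ, 0 < T → ∀ N : ℕ, 2 ≤ N →
          ∃ δ₀ η C : ℝ, ∃ k : ℕ, 0 < δ₀ ∧ 0 < η ∧ η < 1 / (4 * T) ∧
          ∃ φ : ℝ → PhaseSpace N → ℝ, ∃ d₀ : PhaseSpace N → ℝ,
            (∀ δ : ℝ, Measurable (φ δ)) ∧ Measurable d₀ ∧
            (∀ δ : ℝ, δ ≠ 0 → |δ| < δ₀ →
              μ N (T + δ / 2) (T - δ / 2) =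
                ((pinnedChain ω₂ lam β γ).gibbsMeasure N T).withDensity
                  (fun x => ENNReal.ofReal (Real.exp (φ δ x)))) ∧
            (∀ δ : ℝ, |δ| < δ₀ → ∀ x : PhaseSpace N,
              φ δ x ≤ η * (1 + (pinnedChain ω₂ lam β γ).hamiltonian N x)) ∧
            (∀ x : PhaseSpace N, Tendsto (fun δ : ℝ => φ δ x) (𝓝[≠] (0 : ℝ)) (𝓝 0)) ∧
            (∀ δ : ℝ, |δ| < δ₀ → ∀ x : PhaseSpace N,
              |φ δ x - φ δ (x.1, -x.2)| ≤
                C * |δ| * (1 + (pinnedChain ω₂ lam β γ).hamiltonian N x) ^ k) ∧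
            (∀ x : PhaseSpace N,
              Tendsto (fun δ : ℝ => (φ δ x - φ δ (x.1, -x.2)) / δ) (𝓝[≠] (0 : ℝ)) (𝓝 (d₀ x)))) →
    ∀ ω₂ lam β γ : ℝ, 0 < ω₂ → 0 < lam → 0 < β → 0 < γ →
      (∀ (N : ℕ) (T_L T_R : ℝ), 0 < T_L → 0 < T_R → ∀ μ ν : Measure (PhaseSpace N),
        (pinnedChain ω₂ lam β γ).IsSteadyState N T_L T_R μ →
        (pinnedChain ω₂ lam β γ).IsSteadyState N T_L T_R ν → μ = ν) →
      ∀ μ : (N : ℕ) → ℝ → ℝ → Measure (PhaseSpace N),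
        (∀ (N : ℕ) (T_L T_R : ℝ), 0 < T_L → 0 < T_R →
          (pinnedChain ω₂ lam β γ).IsSteadyState N T_L T_R (μ N T_L T_R)) →
        ∀ T : ℝ, 0 < T → ∀ N : ℕ, 2 ≤ N → ∀ h : PhaseSpace N → ℝ,
          (MemLp h 2 (μ N T T) ∧
            (∀ F : PhaseSpace N → ℝ, ContDiff ℝ ((⊤ : ℕ∞) : WithTop ℕ∞) F → HasCompactSupport F →
              Tendsto (fun δ : ℝ => ((∫ x, F x ∂(μ N (T + δ / 2) (T - δ / 2))) - ∫ x, F x ∂(μ N T T)) / δ)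
                (𝓝[≠] (0 : ℝ)) (𝓝 (∫ x, F x * h x ∂(μ N T T)))) ∧
            (∀ i : Fin N, Tendsto (fun δ : ℝ =>
                ((∫ x, (pinnedChain ω₂ lam β γ).bondCurrent N i x ∂(μ N (T + δ / 2) (T - δ / 2))) -
                  ∫ x, (pinnedChain ω₂ lam β γ).bondCurrent N i x ∂(μ N T T)) / δ)
                (𝓝[≠] (0 : ℝ)) (𝓝 (∫ x, (pinnedChain ω₂ lam β γ).bondCurrent N i x * h x ∂(μ N T T))))) →
          ∀ D : ℝ, ∫ x, (h x - h (x.1, -x.2)) ^ 2 ∂(μ N T T) < D →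
            ∀ᶠ δ in 𝓝[≠] (0 : ℝ), ∃ ρ : PhaseSpace N → ℝ, Measurable ρ ∧ (∀ x, 0 < ρ x) ∧
              μ N (T + δ / 2) (T - δ / 2) =
                (volume : Measure (PhaseSpace N)).withDensity (fun x => ENNReal.ofReal (ρ x)) ∧
              Integrable (fun x => (Real.log (ρ x) - Real.log (ρ (x.1, -x.2))) ^ 2)
                (μ N (T + δ / 2) (T - δ / 2)) ∧
              ∫ x, (Real.log (ρ x) - Real.log (ρ (x.1, -x.2))) ^ 2 ∂(μ N (T + δ / 2) (T - δ / 2))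
                ≤ D * δ ^ 2 :=
  -- LANDED (p120594: Theorems/BondHeatUncertaintyExtensiveSnapshotIrreversibilityOddLogDensityOfOddRegularity.lean; Aux1 p119814)
  Summit.AtomisticToContinuum.FouriersLaw.Theorems.ExtensiveSnapshotIrreversibility.ClausiusBudget.stub_oddLogDensity_of_oddRegularity

/-- **S1d `stub_oddLogDensity`** (fixed `N ≥ 2`) — DERIVED: S1r' + S1g' (v8; v7 derived it from the stronger S1r via the landed S1g
p103202). Under the guard, along every steady-state family, for `T > 0`, `N ≥ 2`, every `L²` response density `h` and every
`D > ∫ (h − h∘Θ)² dμ_{N,T,T}`: eventually in `δ ≠ 0` the steady state `μ_{N,T+δ/2,T−δ/2}` has an everywhere POSITIVE measurable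
Lebesgue density `ρ_δ` whose odd log-part satisfies `∫ (log ρ_δ − log ρ_δ∘Θ)² dμ_δ ≤ D δ²`. -/
theorem stub_oddLogDensity :
    ∀ ω₂ lam β γ : ℝ, 0 < ω₂ → 0 < lam → 0 < β → 0 < γ →
      (∀ (N : ℕ) (T_L T_R : ℝ), 0 < T_L → 0 < T_R → ∀ μ ν : Measure (PhaseSpace N),
        (pinnedChain ω₂ lam β γ).IsSteadyState N T_L T_R μ →
        (pinnedChain ω₂ lam β γ).IsSteadyState N T_L T_R ν → μ = ν) →
      ∀ μ : (N : ℕ) → ℝ → ℝ → Measure (PhaseSpace N),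
        (∀ (N : ℕ) (T_L T_R : ℝ), 0 < T_L → 0 < T_R →
          (pinnedChain ω₂ lam β γ).IsSteadyState N T_L T_R (μ N T_L T_R)) →
        ∀ T : ℝ, 0 < T → ∀ N : ℕ, 2 ≤ N → ∀ h : PhaseSpace N → ℝ,
          (MemLp h 2 (μ N T T) ∧
            (∀ F : PhaseSpace N → ℝ, ContDiff ℝ ((⊤ : ℕ∞) : WithTop ℕ∞) F → HasCompactSupport F →
              Tendsto (fun δ : ℝ => ((∫ x, F x ∂(μ N (T + δ / 2) (T - δ / 2))) - ∫ x, F x ∂(μ N T T)) / δ)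
                (𝓝[≠] (0 : ℝ)) (𝓝 (∫ x, F x * h x ∂(μ N T T)))) ∧
            (∀ i : Fin N, Tendsto (fun δ : ℝ =>
                ((∫ x, (pinnedChain ω₂ lam β γ).bondCurrent N i x ∂(μ N (T + δ / 2) (T - δ / 2))) -
                  ∫ x, (pinnedChain ω₂ lam β γ).bondCurrent N i x ∂(μ N T T)) / δ)
                (𝓝[≠] (0 : ℝ)) (𝓝 (∫ x, (pinnedChain ω₂ lam β γ).bondCurrent N i x * h x ∂(μ N T T))))) →
          ∀ D : ℝ, ∫ x, (h x - h (x.1, -x.2)) ^ 2 ∂(μ N T T) < D →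
            ∀ᶠ δ in 𝓝[≠] (0 : ℝ), ∃ ρ : PhaseSpace N → ℝ, Measurable ρ ∧ (∀ x, 0 < ρ x) ∧
              μ N (T + δ / 2) (T - δ / 2) =
                (volume : Measure (PhaseSpace N)).withDensity (fun x => ENNReal.ofReal (ρ x)) ∧
              Integrable (fun x => (Real.log (ρ x) - Real.log (ρ (x.1, -x.2))) ^ 2)
                (μ N (T + δ / 2) (T - δ / 2)) ∧
              ∫ x, (Real.log (ρ x) - Real.log (ρ (x.1, -x.2))) ^ 2 ∂(μ N (T + δ / 2) (T - δ / 2))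
                ≤ D * δ ^ 2 :=
  stub_oddLogDensity_of_oddRegularity stub_oddLogDensityRegularity


/-- **S1c `stub_snapshotKLUpper`** (fixed `N ≥ 2`, size L; THE unprinted fixed-`N` debt shared by every line of this crux,
Disproof §7/§9). Under the guard, along every steady-state family, for `T > 0`, `N ≥ 2` and EVERY `L²` response density
`h` (interface verbatim as in `ResponseDensity`): for every `K > ½∫(h − h∘Θ)² d(μ N T T)`, eventually in `δ ≠ 0`,
`KL(μ_δ ‖ Θ_*μ_δ) ≤ K δ²` — the UPPER half of the second-order expansion `KL = ½δ²D(h) + o(δ²)`, which carries FINITENESS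
of `KL` for small `δ` (positive NESS density `ρ_δ = e^{φ_δ}ρ_T`, `φ_δ − φ_δ∘Θ ∈ L¹(μ_δ)`: exact criterion and the
tilted sandwich `½∫d²e^{−d/2}dμ_δ ≤ KL ≤ ∫d² dμ_δ`, `d = φ_δ − φ_δ∘Θ`, are LANDED in Negative/TiltedCriterion, TiltedFloor;
what is missing is `d = δ(h − h∘Θ) + o(δ)` in `L²(μ_δ)` — two-sided control of the NESS log-density to first order,
"not in print": hypoelliptic regularity + Gaussian-type tails, cf. Rey-Bellet–Thomas 2002 upper tails). Uniqueness of
`h` a.e. (weak derivatives are unique in `L²`) makes "every `h`" and "some `h`" equivalent. -/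
theorem stub_snapshotKLUpper :
    ∀ ω₂ lam β γ : ℝ, 0 < ω₂ → 0 < lam → 0 < β → 0 < γ →
      (∀ (N : ℕ) (T_L T_R : ℝ), 0 < T_L → 0 < T_R → ∀ μ ν : Measure (PhaseSpace N),
        (pinnedChain ω₂ lam β γ).IsSteadyState N T_L T_R μ →
        (pinnedChain ω₂ lam β γ).IsSteadyState N T_L T_R ν → μ = ν) →
      ∀ μ : (N : ℕ) → ℝ → ℝ → Measure (PhaseSpace N),
        (∀ (N : ℕ) (T_L T_R : ℝ), 0 < T_L → 0 < T_R →
          (pinnedChain ω₂ lam β γ).IsSteadyState N T_L T_R (μ N T_L T_R)) →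
        ∀ T : ℝ, 0 < T → ∀ N : ℕ, 2 ≤ N → ∀ h : PhaseSpace N → ℝ,
          (MemLp h 2 (μ N T T) ∧
            (∀ F : PhaseSpace N → ℝ, ContDiff ℝ ((⊤ : ℕ∞) : WithTop ℕ∞) F → HasCompactSupport F →
              Tendsto (fun δ : ℝ => ((∫ x, F x ∂(μ N (T + δ / 2) (T - δ / 2))) - ∫ x, F x ∂(μ N T T)) / δ)
                (𝓝[≠] (0 : ℝ)) (𝓝 (∫ x, F x * h x ∂(μ N T T)))) ∧
            (∀ i : Fin N, Tendsto (fun δ : ℝ =>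
                ((∫ x, (pinnedChain ω₂ lam β γ).bondCurrent N i x ∂(μ N (T + δ / 2) (T - δ / 2))) -
                  ∫ x, (pinnedChain ω₂ lam β γ).bondCurrent N i x ∂(μ N T T)) / δ)
                (𝓝[≠] (0 : ℝ)) (𝓝 (∫ x, (pinnedChain ω₂ lam β γ).bondCurrent N i x * h x ∂(μ N T T))))) →
          ∀ K : ℝ, (1 / 2 : ℝ) * ∫ x, (h x - h (x.1, -x.2)) ^ 2 ∂(μ N T T) < K →
            ∀ᶠ δ in 𝓝[≠] (0 : ℝ),
              klDiv (μ N (T + δ / 2) (T - δ / 2))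
                  (Measure.map (fun x : PhaseSpace N => (x.1, -x.2)) (μ N (T + δ / 2) (T - δ / 2)))
                ≤ ENNReal.ofReal (K * δ ^ 2) :=
  -- CLOSED modulo S1d by the LANDED reduction (p91778): Theorems/…SnapshotKLUpperReduction.lean
  Summit.AtomisticToContinuum.FouriersLaw.Theorems.ExtensiveSnapshotIrreversibility.ClausiusBudget.stub_snapshotKLUpper_of_density
    stub_oddLogDensity

/-- **S2a `stub_correctorIntegrability`** (fixed `N ≥ 2`, size M/L, provable now). Given (INV) and (MIX): the McLennan
integral converges absolutely for every starting point, `w`, `k τ`, `P_τ w ∈ L²(μ_T)`, and the WINDOW IDENTITY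
`w = k τ + P_τ w` holds POINTWISE for every `τ ≥ 0`. Why true: `|g| ≤ (γ/T²)(1/ϑ)e^{ϑH}` (`H ≥ 0`,
`pinnedChain_hamiltonian_nonneg`) and `μ_T(g) = 0` (the two contact momenta are identically distributed under `μ_T`:
reflection symmetry of the Gibbs density / `p_i ~ N(0,T)` given `q`), so (MIX) with `ϑ = 1/(4T)` gives
`|Pg s z| ≤ C' e^{ϑH(z)} e^{−cs}`: integrable in `s`; `|w z| ≤ (C'/c) e^{ϑH(z)}` with `e^{2ϑH} ∈ L¹(μ_T)`
(`pinnedChain_integrable_exp_mul_hamiltonian_gibbsMeasure`, `2ϑ < 1/T`); `∫_{s>τ} Pg s z ds = ∫_{u>0} Pg (τ+u) z du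
= ∫ (∫_{u>0} Pg u x du) d(κ_τ z)(x) = P_τ w (z)` by Chapman–Kolmogorov (`pinnedChain_transitionKernel_add`) and Fubini
(integrable majorant `(C'/c) e^{ϑH(x)}`, `∫ e^{ϑH} dκ_τ(z) ≤ e^{2ϑγTτ} e^{ϑH(z)}`:
`lintegral_exp_mul_hamiltonian_pinnedChainSemigroup_le`); measurability from `pinnedChain_measurable_transitionKernel` /
`stronglyMeasurable_uncurry_act`. -/
theorem stub_correctorIntegrability :
    ∀ ω₂ lam β γ : ℝ, 0 < ω₂ → 0 < lam → 0 < β → 0 < γ → ∀ T : ℝ, 0 < T → ∀ (N : ℕ) (hN : 2 ≤ N),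
      let P := pinnedChain ω₂ lam β γ
      let μT := P.gibbsMeasure N T
      (∀ t : ℝ≥0, μT.bind (P.transitionKernel N T T t) = μT) →
      (∀ ϑ : ℝ, 0 < ϑ → ϑ < 1 / T → ∃ C c : ℝ, 0 < C ∧ 0 < c ∧
        ∀ (z : PhaseSpace N) (t : ℝ≥0) (f : PhaseSpace N → ℝ), Continuous f →
          (∀ y, |f y| ≤ Real.exp (ϑ * P.hamiltonian N y)) →
          |(∫ y, f y ∂(P.transitionKernel N T T t z)) - ∫ y, f y ∂μT| ≤
            C * Real.exp (ϑ * P.hamiltonian N z) * Real.exp (-c * t)) →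
      let g : PhaseSpace N → ℝ := fun y =>
        γ / (2 * T ^ 2) * (y.2 ⟨0, by omega⟩ ^ 2 - y.2 ⟨N - 1, by omega⟩ ^ 2)
      let Pg : ℝ → PhaseSpace N → ℝ := fun s z => ∫ y, g y ∂(P.transitionKernel N T T s.toNNReal z)
      let k : ℝ → PhaseSpace N → ℝ := fun τ z => ∫ s in (0 : ℝ)..τ, Pg s z
      let w : PhaseSpace N → ℝ := fun z => ∫ s in Set.Ioi (0 : ℝ), Pg s z
      let Pw : ℝ → PhaseSpace N → ℝ := fun τ z => ∫ x, w x ∂(P.transitionKernel N T T τ.toNNReal z)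
      (∀ z : PhaseSpace N, IntegrableOn (fun s => Pg s z) (Set.Ioi (0 : ℝ))) ∧
      MemLp w 2 μT ∧
      ∀ τ : ℝ, 0 ≤ τ → MemLp (k τ) 2 μT ∧ MemLp (Pw τ) 2 μT ∧ ∀ z : PhaseSpace N, w z = k τ z + Pw τ z :=
  -- LANDED (p81088): Theorems/BondHeatUncertaintyExtensiveSnapshotIrreversibilityCorrectorIntegrability.lean
  Summit.AtomisticToContinuum.FouriersLaw.Theorems.ExtensiveSnapshotIrreversibility.ClausiusBudget.stub_correctorIntegrability

/-- **S2b `stub_correctorCocycle`** (fixed `N`, size M, provable now; pure `L²(μ_T)` bookkeeping). For `T > 0`, `τ`, and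
functions `w, kτ, Pwτ ∈ L²(μ_T)` with `w = kτ + Pwτ` pointwise:
`√∫(w − w∘Θ)² dμ_T ≤ 2√∫kτ² dμ_T + √∫(Pwτ − Pwτ∘Θ)² dμ_T` — Minkowski in `L²(μ_T)` and `‖kτ∘Θ‖ = ‖kτ‖` by the
flip-invariance of the Gibbs measure (`gibbsMeasure_map_flip`, landed in Negative/DegenerateInstances; `integral_map`).
Stated for ARBITRARY functions (the line instantiates `w, k τ, Pw τ` of S2a), so no kernel enters. -/
theorem stub_correctorCocycle :
    ∀ ω₂ lam β γ : ℝ, 0 < ω₂ → 0 < lam → 0 < β → 0 < γ → ∀ T : ℝ, 0 < T → ∀ (N : ℕ),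
      ∀ w kτ Pwτ : PhaseSpace N → ℝ,
        MemLp w 2 ((pinnedChain ω₂ lam β γ).gibbsMeasure N T) →
        MemLp kτ 2 ((pinnedChain ω₂ lam β γ).gibbsMeasure N T) →
        MemLp Pwτ 2 ((pinnedChain ω₂ lam β γ).gibbsMeasure N T) →
        (∀ z : PhaseSpace N, w z = kτ z + Pwτ z) →
        Real.sqrt (∫ z, (w z - w (z.1, -z.2)) ^ 2 ∂((pinnedChain ω₂ lam β γ).gibbsMeasure N T)) ≤
          2 * Real.sqrt (∫ z, (kτ z) ^ 2 ∂((pinnedChain ω₂ lam β γ).gibbsMeasure N T)) +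
            Real.sqrt (∫ z, (Pwτ z - Pwτ (z.1, -z.2)) ^ 2 ∂((pinnedChain ω₂ lam β γ).gibbsMeasure N T)) :=
  -- LANDED (p82521): Theorems/BondHeatUncertaintyExtensiveSnapshotIrreversibilityCorrectorCocycle.lean
  Summit.AtomisticToContinuum.FouriersLaw.Theorems.ExtensiveSnapshotIrreversibility.ClausiusBudget.stub_correctorCocycle

/-- **S3a `stub_gibbsContactCalculus`** (STATIC, every `N ≥ 1`, size M, provable now from `integral_liouville_mul_gibbsDensity`
/ `integral_bath_mul_gibbsDensity` / `integral_mul_eq_neg_of_hasLineDerivAt`). For `T > 0` and every `f ∈ C_c^∞`: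
(a) the `L²(μ_T)` DIRICHLET FORM of the equilibrium generator is the Ornstein–Uhlenbeck form of the two contact momenta,
`∫ f · (L_{T,T} f) dμ_T = −γT Σ_i (1[i=0] + 1[i=N−1]) ∫ (∂_{p_i} f)² dμ_T` (the Liouville part is antisymmetric: apply
`∫ L(f²) dμ_T = 0` — Gibbs is steady — and the product rule `L(f²) = 2fLf + 2γ Σ_b T (∂_{p_b}f)²`); (b) GAUSSIAN
INTEGRATION BY PARTS in a contact momentum: `∫ (p_i² − T) f dμ_T = T ∫ p_i ∂_{p_i} f dμ_T` for every site `i`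
(`∂_{p_i} e^{−H/T} = −(p_i/T) e^{−H/T}`). Both are bulk-independent identities; (a)+(b)+Cauchy–Schwarz are the pointwise-in-time
content of the Clausius budget. -/
theorem stub_gibbsContactCalculus :
    ∀ ω₂ lam β γ : ℝ, 0 < ω₂ → 0 < lam → 0 < β → 0 < γ → ∀ T : ℝ, 0 < T → ∀ N : ℕ, 0 < N →
      ∀ f : PhaseSpace N → ℝ, ContDiff ℝ (⊤ : ℕ∞) f → HasCompactSupport f →
        (∫ x, f x * (pinnedChain ω₂ lam β γ).generator N T T f x ∂((pinnedChain ω₂ lam β γ).gibbsMeasure N T) =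
          -(γ * T) * ∑ i : Fin N, ((if i.val = 0 then (1 : ℝ) else 0) + (if i.val = N - 1 then (1 : ℝ) else 0)) *
            ∫ x, (partialP i f x) ^ 2 ∂((pinnedChain ω₂ lam β γ).gibbsMeasure N T)) ∧
        (∀ i : Fin N, ∫ x, (x.2 i ^ 2 - T) * f x ∂((pinnedChain ω₂ lam β γ).gibbsMeasure N T) =
          T * ∫ x, x.2 i * partialP i f x ∂((pinnedChain ω₂ lam β γ).gibbsMeasure N T)) :=
  -- LANDED (p82446): Theorems/BondHeatUncertaintyExtensiveSnapshotIrreversibilityGibbsContactCalculus.lean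
  Summit.AtomisticToContinuum.FouriersLaw.Theorems.ExtensiveSnapshotIrreversibility.ClausiusBudget.stub_gibbsContactCalculus

/-- **S3b `stub_clausiusBudget`** (THE LEVER; every `N ≥ 2`, constant free of `N` and of the bulk potentials; size L/XL as a
formalisation). Under the guard, for `T > 0`, given (INV), (MIX), the static contact calculus (a)/(b) of S3a on `C_c^∞`, and
`k τ ∈ L²(μ_T)` for all `τ ≥ 0`: `‖k τ‖²_{L²(μ_T)} ≤ γτ/(4T²)` for every `τ ≥ 0`.
Why true ("the arrow of time can only be pumped at the Clausius rate"): `k_t` solves `d/dt k_t = L_T k_t + g`, `k_0 = 0`;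
by (a) `d/dt ½‖k_t‖² = −γT Σ_{i∈∂}‖∂_{p_i}k_t‖² + ⟨g, k_t⟩`, by (b) and Cauchy–Schwarz (`‖p_i‖_{L²(μ_T)} = √T`)
`|⟨g, k_t⟩| ≤ (γ/2√T)(‖∂_{p_0}k_t‖ + ‖∂_{p_{N−1}}k_t‖)`, hence `d/dt ½‖k_t‖² ≤ 2·max_x(−γTx² + γx/(2√T)) = γ/(8T²)`.
Debt (the formalisation content): extending (a)/(b) from `C_c^∞` to the orbit `k_t` (regularity/growth of `P_s g`, energy
identity for the hypoelliptic semigroup on a core, or a mollified/Steklov version of the argument); harmonic check: max ratio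
`0.770–0.814 < 1` (pure OU transient `(1−e^{−2x})²/x ≤ 0.8145`). -/
theorem stub_clausiusBudget :
    ∀ ω₂ lam β γ : ℝ, 0 < ω₂ → 0 < lam → 0 < β → 0 < γ →
      (∀ (N : ℕ) (T_L T_R : ℝ), 0 < T_L → 0 < T_R → ∀ μ ν : Measure (PhaseSpace N),
        (pinnedChain ω₂ lam β γ).IsSteadyState N T_L T_R μ →
        (pinnedChain ω₂ lam β γ).IsSteadyState N T_L T_R ν → μ = ν) →
      ∀ T : ℝ, 0 < T → ∀ (N : ℕ) (hN : 2 ≤ N),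
        let P := pinnedChain ω₂ lam β γ
        let μT := P.gibbsMeasure N T
        (∀ t : ℝ≥0, μT.bind (P.transitionKernel N T T t) = μT) →
        (∀ ϑ : ℝ, 0 < ϑ → ϑ < 1 / T → ∃ C c : ℝ, 0 < C ∧ 0 < c ∧
          ∀ (z : PhaseSpace N) (t : ℝ≥0) (f : PhaseSpace N → ℝ), Continuous f →
            (∀ y, |f y| ≤ Real.exp (ϑ * P.hamiltonian N y)) →
            |(∫ y, f y ∂(P.transitionKernel N T T t z)) - ∫ y, f y ∂μT| ≤
              C * Real.exp (ϑ * P.hamiltonian N z) * Real.exp (-c * t)) →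
        (∀ f : PhaseSpace N → ℝ, ContDiff ℝ (⊤ : ℕ∞) f → HasCompactSupport f →
          (∫ x, f x * P.generator N T T f x ∂μT =
            -(γ * T) * ∑ i : Fin N, ((if i.val = 0 then (1 : ℝ) else 0) + (if i.val = N - 1 then (1 : ℝ) else 0)) *
              ∫ x, (partialP i f x) ^ 2 ∂μT) ∧
          (∀ i : Fin N, ∫ x, (x.2 i ^ 2 - T) * f x ∂μT = T * ∫ x, x.2 i * partialP i f x ∂μT)) →
        let g : PhaseSpace N → ℝ := fun y =>
          γ / (2 * T ^ 2) * (y.2 ⟨0, by omega⟩ ^ 2 - y.2 ⟨N - 1, by omega⟩ ^ 2)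
        let Pg : ℝ → PhaseSpace N → ℝ := fun s z => ∫ y, g y ∂(P.transitionKernel N T T s.toNNReal z)
        let k : ℝ → PhaseSpace N → ℝ := fun τ z => ∫ s in (0 : ℝ)..τ, Pg s z
        (∀ τ : ℝ, 0 ≤ τ → MemLp (k τ) 2 μT) →
        ∀ τ : ℝ, 0 ≤ τ → ∫ z, (k τ z) ^ 2 ∂μT ≤ γ * τ / (4 * T ^ 2) :=
  -- LANDED (p89857): Theorems/BondHeatUncertaintyExtensiveSnapshotIrreversibilityClausiusBudget.lean
  Summit.AtomisticToContinuum.FouriersLaw.Theorems.ExtensiveSnapshotIrreversibility.ClausiusBudget.stub_clausiusBudget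

/-! ### The three new stubs of this line (S_A, S_B fixed-`N`/provable; S_C the `N`-uniform residual)

Common dictionary (for `P = pinnedChain ω₂ lam β γ`, `N ≥ 2`, `T > 0`): `μT := P.gibbsMeasure N T` (normalised, `Θ`-invariant);
`J := Σ_i j_i` the total current; `u` ANY `L²(μT)` a.e.-limit of the finite-horizon Kubo integrals `∫₀^τ P_t J dt` (the predicate
of S4k / of the sibling items `OddDensityIsCorrector` 9146 and `ConeScaleCorrector` E1, verbatim; existence, `C¹` and `L²`-limit:
`CorrectorTheory` 14071, PROVED); `uo := ½(u − u∘Θ)` its odd part; `Puo t z := ∫ uo d(P.transitionKernel N T T t z)`;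
`GK := ∫_{t>0} ∫ uo · Puo t dμT dt` the Green–Kubo integral of `uo`. -/

/-- **S_A `stub_tapDualityOddCorrector`** (fixed `N ≥ 2`, size L, provable from landed corrector calculus).  TAP DUALITY:
the Green–Kubo integral of the odd corrector converges absolutely and `(∫ uo² dμT)² ≤ ⟨u, J⟩_{μT} · GK(uo)`.
Proof route: (i) `|P_t J| ≤ C e^{ϑH} e^{−ct}` ((MIX), S0) makes `u`, `uo` continuous versions with `|uo| ≤ C′e^{ϑH}`, `μT(uo) = 0`
(oddness + `gibbsMeasure_map_flip`), so `t ↦ ⟨uo, P_t uo⟩` is `O(e^{−ct})` and `v := ∫₀^∞ P_t† uo dt = −(∫₀^∞ P_t uo dt)∘Θ`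
exists (`P_t† = ΘP_tΘ`, kernel detailed balance as in S1a / `OddDensityIsCorrectorDetailedBalance`); (ii) weak Poisson equations
`−L u = J` (CorrectorTheory) and its parity split, even part `A uo + S ue = 0` (CorrectorTheory (7)'s engine) ⇒ `−L uo = S(u∘Θ)`
weakly; (iii) `∫uo² = ⟨uo, (−L†)v⟩ = ⟨(−L)uo, v⟩ = ⟨S(u∘Θ), v⟩ = −γT Σ_b ⟨∂_{p_b}(u∘Θ), ∂_{p_b}v⟩` (OU form of the taps,
`stub_gibbsContactCalculus` S3a landed); (iv) Cauchy–Schwarz with `Σ_b‖∂_{p_b}(u∘Θ)‖² = Σ_b‖∂_{p_b}u‖² = ⟨u,J⟩/(γT)`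
(CorrectorTheory (6), flip-invariance of `μT`) and `γTΣ_b‖∂_{p_b}v‖² = ⟨v, (−L†)v⟩ = ⟨v, uo⟩ = GK(uo)` (tap energy identity for the
adjoint corrector).  Exact Gaussian check: ratio `(∫uo²)²/(⟨u,J⟩·GK) ∈ [0.12, 1.0000]` over nine parameter points, `N ≤ 256`. -/
theorem stub_tapDualityOddCorrector :
    ∀ ω₂ lam β γ : ℝ, 0 < ω₂ → 0 < lam → 0 < β → 0 < γ → ∀ T : ℝ, 0 < T →
      ∀ (N : ℕ) (u : PhaseSpace N → ℝ), 2 ≤ N →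
        MemLp u 2 ((pinnedChain ω₂ lam β γ).gibbsMeasure N T) →
        (∀ᵐ x ∂((pinnedChain ω₂ lam β γ).gibbsMeasure N T),
          Tendsto (fun τ : ℝ => ∫ t in Set.Ioc (0 : ℝ) τ,
            (∫ y, (∑ i : Fin N, (pinnedChain ω₂ lam β γ).bondCurrent N i y)
              ∂((pinnedChain ω₂ lam β γ).transitionKernel N T T t.toNNReal x))) atTop (𝓝 (u x))) →
        IntegrableOn (fun t : ℝ => ∫ z, (u z - u (z.1, -z.2)) / 2 *
              (∫ y, (u y - u (y.1, -y.2)) / 2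
                ∂((pinnedChain ω₂ lam β γ).transitionKernel N T T t.toNNReal z))
              ∂((pinnedChain ω₂ lam β γ).gibbsMeasure N T)) (Set.Ioi 0) ∧
        (∫ z, ((u z - u (z.1, -z.2)) / 2) ^ 2 ∂((pinnedChain ω₂ lam β γ).gibbsMeasure N T)) ^ 2 ≤
          (∫ z, u z * (∑ i : Fin N, (pinnedChain ω₂ lam β γ).bondCurrent N i z)
              ∂((pinnedChain ω₂ lam β γ).gibbsMeasure N T)) *
            ∫ t in Set.Ioi (0 : ℝ), ∫ z, (u z - u (z.1, -z.2)) / 2 *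
              (∫ y, (u y - u (y.1, -y.2)) / 2
                ∂((pinnedChain ω₂ lam β γ).transitionKernel N T T t.toNNReal z))
              ∂((pinnedChain ω₂ lam β γ).gibbsMeasure N T) :=
  -- LANDED p141654 (S_A, worker-SA wave 2, lead c5): `Theorems/BondHeatUncertaintyExtensiveSnapshotIrreversibilityTapDualityOddCorrector.lean`
  Summit.AtomisticToContinuum.FouriersLaw.Theorems.ExtensiveSnapshotIrreversibility.TapDuality.stub_tapDualityOddCorrector

/-- **S_B `stub_totalGreenKuboCap`** (fixed `N ≥ 2`, `N`-uniform constant, size M, provable now).  The total Green–Kubo integral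
`⟨u, J⟩_{μT}` (= `(N−1)T²D_N` by `CorrectorTheory`'s Green–Kubo conjunct) is nonnegative and at most `γ T² (N−1)²`: the
EQUILIBRIUM conductance cap `G_N ≤ γ`.  Route: `0 ≤` is the tap energy identity (6); for `≤`, bond sum rule (5) gives
`⟨u,J⟩ = (N−1)⟨u, j_0⟩`; the contact-bond identity `⟨u, j_0⟩ = ⟨u, f_L⟩`, `f_L = γ(p_0² − T)` (site-0 balance `−L e_0 = j_0 + f_L`,
`−L = −L† − 2A`, `A e_0 = −j_0`, `⟨J, e_0⟩ = 0`, so `⟨u, −Le_0⟩ = ⟨J, e_0⟩ + 2⟨u, j_0⟩ = 2⟨u, j_0⟩`); Gaussian IBP in `p_0`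
(`integral_sq_sub_mul_gibbsDensity`, landed with S3a) `⟨u, p_0² − T⟩ = T⟨∂_{p_0}u, p_0⟩ ≤ T^{3/2}‖∂_{p_0}u‖`; and (6) again:
`x := ⟨u,j_0⟩` obeys `x² ≤ γ²T³‖∂_{p_0}u‖² ≤ γT²(N−1)x`.  (With the chain reflection `‖∂_{p_0}u‖ = ‖∂_{p_{N−1}}u‖` one gets `γ/2`,
the NESS contact anchor `γT³(ι_0+ι_{N−1}) = γ/2 − G_N`; the weaker `γ` suffices here.) -/
theorem stub_totalGreenKuboCap :
    ∀ ω₂ lam β γ : ℝ, 0 < ω₂ → 0 < lam → 0 < β → 0 < γ → ∀ T : ℝ, 0 < T →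
      ∀ (N : ℕ) (u : PhaseSpace N → ℝ), 2 ≤ N →
        MemLp u 2 ((pinnedChain ω₂ lam β γ).gibbsMeasure N T) →
        (∀ᵐ x ∂((pinnedChain ω₂ lam β γ).gibbsMeasure N T),
          Tendsto (fun τ : ℝ => ∫ t in Set.Ioc (0 : ℝ) τ,
            (∫ y, (∑ i : Fin N, (pinnedChain ω₂ lam β γ).bondCurrent N i y)
              ∂((pinnedChain ω₂ lam β γ).transitionKernel N T T t.toNNReal x))) atTop (𝓝 (u x))) →
        0 ≤ ∫ z, u z * (∑ i : Fin N, (pinnedChain ω₂ lam β γ).bondCurrent N i z)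
            ∂((pinnedChain ω₂ lam β γ).gibbsMeasure N T) ∧
        ∫ z, u z * (∑ i : Fin N, (pinnedChain ω₂ lam β γ).bondCurrent N i z)
            ∂((pinnedChain ω₂ lam β γ).gibbsMeasure N T) ≤ γ * T ^ 2 * ((N : ℝ) - 1) ^ 2 :=
  -- LANDED p141379 (S_B, lead c5): `Theorems/BondHeatUncertaintyExtensiveSnapshotIrreversibilityTotalGreenKuboCap.lean`
  Summit.AtomisticToContinuum.FouriersLaw.Theorems.ExtensiveSnapshotIrreversibility.TapDuality.stub_totalGreenKuboCap

/-- **S_C `stub_oddCorrectorGreenKuboTime`** (HARDEST, the line's `N`-UNIFORM residual, size XL).  For `T > 0` there is `C` with,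
for every `N ≥ 2` and every corrector `u` as above: `GK(uo) ≤ C · N · ∫ uo² dμT` — the Green–Kubo TIME
`τ(uo) := GK(uo)/‖uo‖²` of the odd Kubo corrector is at most BALLISTIC.  Why plausibly true: `uo(z) = ½E[∫_ℝ J dt | z]` is the
forecast of the two-sided transport; forecasts made one causal crossing apart rest on disjoint stretches of boundary-refreshed
dynamics (diffusive/chaotic bulk: `τ(uo) ≍ N/v_B`), and at the ballistic harmonic corner each phonon's forecast flips sign at
every reflection, so its INTEGRATED autocorrelation is `≍ N` although its norm lives `≍ N³` (exact: `τ(uo)/N → 0.68` at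
(ω₂,γ,T) = (1,1,1), `0.195 … 1.36` over eight more points, kit j022073, `N ≤ 256`).  Why it might fail: a family of odd beats
whose sign pattern does NOT alternate (sticky breathers carrying a d.c. transport forecast for `≫ N` without reflecting), or
weak-coupling growth `C(γ) ↑` as `γ → 0` becoming `N`-dependent at fixed small `γ`.  Tools it is open to: KLO variational formula
for `⟨φ, (−L)⁻¹φ⟩` with closed-flow test functions (the sibling's witness technology), asymptotic-variance bounds for the additive
functional `∫₀^t uo(z_s)ds`.  With S_A, S_B it yields S4k (`C·N³`) and, where `D_N = O(1)`, the odd half of E1 at scale `N²`. -/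
theorem stub_oddCorrectorGreenKuboTime :
    ∀ ω₂ lam β γ : ℝ, 0 < ω₂ → 0 < lam → 0 < β → 0 < γ → ∀ T : ℝ, 0 < T → ∃ C : ℝ,
      ∀ (N : ℕ) (u : PhaseSpace N → ℝ), 2 ≤ N →
        MemLp u 2 ((pinnedChain ω₂ lam β γ).gibbsMeasure N T) →
        (∀ᵐ x ∂((pinnedChain ω₂ lam β γ).gibbsMeasure N T),
          Tendsto (fun τ : ℝ => ∫ t in Set.Ioc (0 : ℝ) τ,
            (∫ y, (∑ i : Fin N, (pinnedChain ω₂ lam β γ).bondCurrent N i y)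
              ∂((pinnedChain ω₂ lam β γ).transitionKernel N T T t.toNNReal x))) atTop (𝓝 (u x))) →
        ∫ t in Set.Ioi (0 : ℝ), ∫ z, (u z - u (z.1, -z.2)) / 2 *
              (∫ y, (u y - u (y.1, -y.2)) / 2
                ∂((pinnedChain ω₂ lam β γ).transitionKernel N T T t.toNNReal z))
              ∂((pinnedChain ω₂ lam β γ).gibbsMeasure N T) ≤
          C * N * ∫ z, ((u z - u (z.1, -z.2)) / 2) ^ 2 ∂((pinnedChain ω₂ lam β γ).gibbsMeasure N T) := by
  sorry

/-- Real arithmetic of the tap-duality composition: `a² ≤ D·g`, `0 ≤ D ≤ cap`, `g ≤ C'·Nr·a` (`a, cap, C', Nr ≥ 0`) give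
`a ≤ cap·C'·Nr`. -/
theorem le_of_tapDuality_parts {a D g cap C' Nr : ℝ} (ha : 0 ≤ a) (h1 : a ^ 2 ≤ D * g) (h2 : 0 ≤ D)
    (h3 : D ≤ cap) (hcap : 0 ≤ cap) (hC' : 0 ≤ C') (hN : 0 ≤ Nr) (h4 : g ≤ C' * Nr * a) :
    a ≤ cap * C' * Nr := by
  have hM : 0 ≤ cap * C' * Nr := by positivity
  have hDg : D * g ≤ cap * (C' * Nr * a) := by
    rcases le_or_gt 0 g with hg | hg
    · calc D * g ≤ cap * g := mul_le_mul_of_nonneg_right h3 hg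
        _ ≤ cap * (C' * Nr * a) := mul_le_mul_of_nonneg_left h4 hcap
    · have h0 : D * g ≤ 0 := mul_nonpos_of_nonneg_of_nonpos h2 hg.le
      have h1' : 0 ≤ cap * (C' * Nr * a) := by positivity
      linarith
  have key : a ^ 2 ≤ (cap * C' * Nr) * a := by nlinarith [h1, hDg]
  by_contra hlt0
  have hlt : cap * C' * Nr < a := not_le.mp hlt0
  have hapos : 0 < a := lt_of_le_of_lt hM hlt
  nlinarith [key, hapos, hlt]

/-- **S4k DERIVED** (`stub_kuboCorrectorOddCubicBound` of v10, statement byte-for-byte): the cubic odd bound on the Kubo corrector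
from S_A, S_B, S_C with constant `4γT²·max(C,0)`. -/
theorem kuboCorrectorOddCubicBound_of_tapDuality
    (hA : ∀ ω₂ lam β γ : ℝ, 0 < ω₂ → 0 < lam → 0 < β → 0 < γ → ∀ T : ℝ, 0 < T →
      ∀ (N : ℕ) (u : PhaseSpace N → ℝ), 2 ≤ N →
        let P := pinnedChain ω₂ lam β γ
        let μT := P.gibbsMeasure N T
        let J : PhaseSpace N → ℝ := fun z => ∑ i : Fin N, P.bondCurrent N i z
        MemLp u 2 μT →
        (∀ᵐ x ∂μT, Tendsto (fun τ : ℝ => ∫ t in Set.Ioc (0 : ℝ) τ,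
            (∫ y, J y ∂(P.transitionKernel N T T t.toNNReal x))) atTop (𝓝 (u x))) →
        let uo : PhaseSpace N → ℝ := fun x => (u x - u (x.1, -x.2)) / 2
        let Puo : ℝ → PhaseSpace N → ℝ := fun t z => ∫ y, uo y ∂(P.transitionKernel N T T t.toNNReal z)
        IntegrableOn (fun t : ℝ => ∫ z, uo z * Puo t z ∂μT) (Set.Ioi 0) ∧
        (∫ z, (uo z) ^ 2 ∂μT) ^ 2 ≤
          (∫ z, u z * J z ∂μT) * ∫ t in Set.Ioi (0 : ℝ), ∫ z, uo z * Puo t z ∂μT)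
    (hB : ∀ ω₂ lam β γ : ℝ, 0 < ω₂ → 0 < lam → 0 < β → 0 < γ → ∀ T : ℝ, 0 < T →
      ∀ (N : ℕ) (u : PhaseSpace N → ℝ), 2 ≤ N →
        let P := pinnedChain ω₂ lam β γ
        let μT := P.gibbsMeasure N T
        let J : PhaseSpace N → ℝ := fun z => ∑ i : Fin N, P.bondCurrent N i z
        MemLp u 2 μT →
        (∀ᵐ x ∂μT, Tendsto (fun τ : ℝ => ∫ t in Set.Ioc (0 : ℝ) τ,
            (∫ y, J y ∂(P.transitionKernel N T T t.toNNReal x))) atTop (𝓝 (u x))) →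
        0 ≤ ∫ z, u z * J z ∂μT ∧ ∫ z, u z * J z ∂μT ≤ γ * T ^ 2 * ((N : ℝ) - 1) ^ 2)
    (hC : ∀ ω₂ lam β γ : ℝ, 0 < ω₂ → 0 < lam → 0 < β → 0 < γ → ∀ T : ℝ, 0 < T → ∃ C : ℝ,
      ∀ (N : ℕ) (u : PhaseSpace N → ℝ), 2 ≤ N →
        let P := pinnedChain ω₂ lam β γ
        let μT := P.gibbsMeasure N T
        let J : PhaseSpace N → ℝ := fun z => ∑ i : Fin N, P.bondCurrent N i z
        MemLp u 2 μT →
        (∀ᵐ x ∂μT, Tendsto (fun τ : ℝ => ∫ t in Set.Ioc (0 : ℝ) τ,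
            (∫ y, J y ∂(P.transitionKernel N T T t.toNNReal x))) atTop (𝓝 (u x))) →
        let uo : PhaseSpace N → ℝ := fun x => (u x - u (x.1, -x.2)) / 2
        let Puo : ℝ → PhaseSpace N → ℝ := fun t z => ∫ y, uo y ∂(P.transitionKernel N T T t.toNNReal z)
        ∫ t in Set.Ioi (0 : ℝ), ∫ z, uo z * Puo t z ∂μT ≤ C * N * ∫ z, (uo z) ^ 2 ∂μT) :
    ∀ ω₂ lam β γ : ℝ, 0 < ω₂ → 0 < lam → 0 < β → 0 < γ → ∀ T : ℝ, 0 < T → ∃ C : ℝ,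
      ∀ (N : ℕ) (u : PhaseSpace N → ℝ), 2 ≤ N →
        let P := pinnedChain ω₂ lam β γ
        let μT := P.gibbsMeasure N T
        let J : PhaseSpace N → ℝ := fun z => ∑ i : Fin N, P.bondCurrent N i z
        MemLp u 2 μT →
        (∀ᵐ x ∂μT, Tendsto (fun τ : ℝ => ∫ t in Set.Ioc (0 : ℝ) τ,
            (∫ y, J y ∂(P.transitionKernel N T T t.toNNReal x))) atTop (𝓝 (u x))) →
        ∫ x, (u x - u (x.1, -x.2)) ^ 2 ∂μT ≤ C * (N : ℝ) ^ 3 := by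
  intro ω₂ lam β γ hω hl hβ hγ T hT
  obtain ⟨C, hC'⟩ := hC ω₂ lam β γ hω hl hβ hγ T hT
  refine ⟨4 * (γ * T ^ 2) * max C 0, fun N u hN => ?_⟩
  intro P μT J hu hlim
  -- the three stub outputs at this `u`
  obtain ⟨-, h1⟩ := hA ω₂ lam β γ hω hl hβ hγ T hT N u hN hu hlim
  obtain ⟨h2, h3⟩ := hB ω₂ lam β γ hω hl hβ hγ T hT N u hN hu hlim
  have h4 := hC' N u hN hu hlim
  -- abbreviations (definitionally those of the stubs)
  set a : ℝ := ∫ z, ((u z - u (z.1, -z.2)) / 2) ^ 2 ∂μT with ha_def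
  set D : ℝ := ∫ z, u z * J z ∂μT with hD_def
  set g : ℝ := ∫ t in Set.Ioi (0 : ℝ), ∫ z, ((u z - u (z.1, -z.2)) / 2) *
      (∫ y, ((u y - u (y.1, -y.2)) / 2) ∂(P.transitionKernel N T T t.toNNReal z)) ∂μT with hg_def
  have ha : 0 ≤ a := integral_nonneg fun _ => sq_nonneg _
  have hN0 : (0 : ℝ) ≤ N := by positivity
  have hcap : 0 ≤ γ * T ^ 2 * ((N : ℝ) - 1) ^ 2 := by positivity
  have h1' : a ^ 2 ≤ D * g := h1
  have h4' : g ≤ max C 0 * N * a :=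
    (h4 : g ≤ C * N * a).trans (mul_le_mul_of_nonneg_right
      (mul_le_mul_of_nonneg_right (le_max_left C 0) hN0) ha)
  have hle : a ≤ γ * T ^ 2 * ((N : ℝ) - 1) ^ 2 * max C 0 * N :=
    le_of_tapDuality_parts ha h1' h2 h3 hcap (le_max_right C 0) hN0 h4'
  -- `∫ (u − u∘Θ)² = 4a`
  have h4a : ∫ x, (u x - u (x.1, -x.2)) ^ 2 ∂μT = 4 * a := by
    rw [ha_def, ← integral_const_mul]
    refine integral_congr_ae (Filter.Eventually.of_forall fun x => ?_)
    ring
  rw [h4a]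
  have hm : 0 ≤ max C 0 := le_max_right C 0
  have hγT : 0 ≤ γ * T ^ 2 := by positivity
  have hN2 : (2 : ℝ) ≤ N := by exact_mod_cast hN
  have hNm1 : ((N : ℝ) - 1) ^ 2 ≤ (N : ℝ) ^ 2 := by nlinarith [hN2]
  have hprod : γ * T ^ 2 * ((N : ℝ) - 1) ^ 2 * max C 0 * N ≤ γ * T ^ 2 * (N : ℝ) ^ 2 * max C 0 * N := by
    have h := mul_le_mul_of_nonneg_left hNm1 hγT
    have hmn : 0 ≤ max C 0 * (N : ℝ) := mul_nonneg hm hN0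
    calc γ * T ^ 2 * ((N : ℝ) - 1) ^ 2 * max C 0 * N
        = (γ * T ^ 2 * ((N : ℝ) - 1) ^ 2) * (max C 0 * N) := by ring
      _ ≤ (γ * T ^ 2 * (N : ℝ) ^ 2) * (max C 0 * N) := mul_le_mul_of_nonneg_right h hmn
      _ = γ * T ^ 2 * (N : ℝ) ^ 2 * max C 0 * N := by ring
  calc 4 * a ≤ 4 * (γ * T ^ 2 * ((N : ℝ) - 1) ^ 2 * max C 0 * N) := by linarith
    _ ≤ 4 * (γ * T ^ 2 * (N : ℝ) ^ 2 * max C 0 * N) := by linarith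
    _ = 4 * (γ * T ^ 2) * max C 0 * (N : ℝ) ^ 3 := by ring

/-- **S4k `stub_kuboCorrectorOddCubicBound`** — in THIS line a THEOREM (modulo the three stubs), statement verbatim v10's: for `T > 0`
there is `C` such that for every `N ≥ 2` and every `L²(μ_T)` a.e.-limit `u` of the finite-horizon Kubo integrals of the total
current, `∫ (u − u∘Θ)² dμ_T ≤ C·N³`. -/
theorem stub_kuboCorrectorOddCubicBound :
    ∀ ω₂ lam β γ : ℝ, 0 < ω₂ → 0 < lam → 0 < β → 0 < γ → ∀ T : ℝ, 0 < T → ∃ C : ℝ,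
      ∀ (N : ℕ) (u : PhaseSpace N → ℝ), 2 ≤ N →
        let P := pinnedChain ω₂ lam β γ
        let μT := P.gibbsMeasure N T
        let J : PhaseSpace N → ℝ := fun z => ∑ i : Fin N, P.bondCurrent N i z
        MemLp u 2 μT →
        (∀ᵐ x ∂μT, Tendsto (fun τ : ℝ => ∫ t in Set.Ioc (0 : ℝ) τ,
            (∫ y, J y ∂(P.transitionKernel N T T t.toNNReal x))) atTop (𝓝 (u x))) →
        ∫ x, (u x - u (x.1, -x.2)) ^ 2 ∂μT ≤ C * (N : ℝ) ^ 3 :=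
  kuboCorrectorOddCubicBound_of_tapDuality stub_tapDualityOddCorrector stub_totalGreenKuboCap
    stub_oddCorrectorGreenKuboTime

/-- **S4o `stub_oddCorrectorBound`** — DERIVED (v10, c4 lead 2026-08-16): S4o := `oddCorrectorBound_of_kuboCorrectorOddCubic` (landed)
applied to S4k. Statement unchanged since v9 (c3): under the guard, for `T > 0` there is `C` such that for every `N ≥ 2` the McLennan
corrector `w = ∫₀^∞ P_s g ds` (`g = (γ/2T²)(p_0² − p_{N−1}²)`) has `∫ (w − w∘Θ)² dμ_T ≤ C·N` — by S1a–S1d exactly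
`limsup_δ δ⁻² KL ≤ (C/2)·N`, the crux's whole `N`-uniform content. -/
theorem stub_oddCorrectorBound :
    ∀ ω₂ lam β γ : ℝ, 0 < ω₂ → 0 < lam → 0 < β → 0 < γ →
      (∀ (N : ℕ) (T_L T_R : ℝ), 0 < T_L → 0 < T_R → ∀ μ ν : Measure (PhaseSpace N),
        (pinnedChain ω₂ lam β γ).IsSteadyState N T_L T_R μ →
        (pinnedChain ω₂ lam β γ).IsSteadyState N T_L T_R ν → μ = ν) →
      ∀ T : ℝ, 0 < T → ∃ C : ℝ, ∀ (N : ℕ) (hN : 2 ≤ N),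
        let P := pinnedChain ω₂ lam β γ
        let μT := P.gibbsMeasure N T
        let g : PhaseSpace N → ℝ := fun y =>
          γ / (2 * T ^ 2) * (y.2 ⟨0, by omega⟩ ^ 2 - y.2 ⟨N - 1, by omega⟩ ^ 2)
        let Pg : ℝ → PhaseSpace N → ℝ := fun s z => ∫ y, g y ∂(P.transitionKernel N T T s.toNNReal z)
        let w : PhaseSpace N → ℝ := fun z => ∫ s in Set.Ioi (0 : ℝ), Pg s z
        ∫ z, (w z - w (z.1, -z.2)) ^ 2 ∂μT ≤ C * N :=
  Summit.AtomisticToContinuum.FouriersLaw.Theorems.ExtensiveSnapshotIrreversibility.ClausiusBudget.oddCorrectorBound_of_kuboCorrectorOddCubic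
    stub_kuboCorrectorOddCubicBound

/-- **S4 `stub_lateOddResponse`** — DERIVED (v9, c3 lead 2026-08-16): S4 ⟸ S4o at `τ = 0`, `c = 1` (`P_0 = id` by
`pinnedChain_transitionKernel_zero`, `w ∈ L²(μ_T)` from the landed S2a; the same argument is landed stand-alone as
`lateOddResponse_of_oddCorrectorBound`). Statement unchanged since v3: under the guard, for `T > 0` there are `C` and `c > 0`
such that for every `N ≥ 2`, given (INV) and (MIX), SOME `τ ∈ [0, cN]` has `P_τ w ∈ L²(μ_T)` and `D(P_τ w) ≤ C·N`. -/
theorem stub_lateOddResponse :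
    ∀ ω₂ lam β γ : ℝ, 0 < ω₂ → 0 < lam → 0 < β → 0 < γ →
      (∀ (N : ℕ) (T_L T_R : ℝ), 0 < T_L → 0 < T_R → ∀ μ ν : Measure (PhaseSpace N),
        (pinnedChain ω₂ lam β γ).IsSteadyState N T_L T_R μ →
        (pinnedChain ω₂ lam β γ).IsSteadyState N T_L T_R ν → μ = ν) →
      ∀ T : ℝ, 0 < T → ∃ C c : ℝ, 0 < c ∧ ∀ (N : ℕ) (hN : 2 ≤ N),
        let P := pinnedChain ω₂ lam β γ
        let μT := P.gibbsMeasure N T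
        (∀ t : ℝ≥0, μT.bind (P.transitionKernel N T T t) = μT) →
        (∀ ϑ : ℝ, 0 < ϑ → ϑ < 1 / T → ∃ C c : ℝ, 0 < C ∧ 0 < c ∧
          ∀ (z : PhaseSpace N) (t : ℝ≥0) (f : PhaseSpace N → ℝ), Continuous f →
            (∀ y, |f y| ≤ Real.exp (ϑ * P.hamiltonian N y)) →
            |(∫ y, f y ∂(P.transitionKernel N T T t z)) - ∫ y, f y ∂μT| ≤
              C * Real.exp (ϑ * P.hamiltonian N z) * Real.exp (-c * t)) →
        let g : PhaseSpace N → ℝ := fun y =>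
          γ / (2 * T ^ 2) * (y.2 ⟨0, by omega⟩ ^ 2 - y.2 ⟨N - 1, by omega⟩ ^ 2)
        let Pg : ℝ → PhaseSpace N → ℝ := fun s z => ∫ y, g y ∂(P.transitionKernel N T T s.toNNReal z)
        let w : PhaseSpace N → ℝ := fun z => ∫ s in Set.Ioi (0 : ℝ), Pg s z
        let Pw : ℝ → PhaseSpace N → ℝ := fun τ z => ∫ x, w x ∂(P.transitionKernel N T T τ.toNNReal z)
        ∃ τ : ℝ, 0 ≤ τ ∧ τ ≤ c * N ∧ MemLp (Pw τ) 2 μT ∧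
          ∫ z, (Pw τ z - Pw τ (z.1, -z.2)) ^ 2 ∂μT ≤ C * N := by
  intro ω₂ lam β γ hω hl hβ hγ hU T hT
  obtain ⟨C', hC'⟩ := stub_oddCorrectorBound ω₂ lam β γ hω hl hβ hγ hU T hT
  refine ⟨max C' 0, 1, one_pos, fun N hN => ?_⟩
  intro P μT hInv hMix g Pg w Pw
  -- `w ∈ L²(μ_T)` from the landed S2a
  obtain ⟨-, hw2, -⟩ := stub_correctorIntegrability ω₂ lam β γ hω hl hβ hγ T hT N hN hInv hMix
  have hON : ∫ z, (w z - w (z.1, -z.2)) ^ 2 ∂μT ≤ C' * N := hC' N hN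
  -- `P_0 w = w`
  have hP0 : ∀ z, Pw 0 z = w z := by
    intro z
    show ∫ x, w x ∂(P.transitionKernel N T T (Real.toNNReal 0) z) = w z
    rw [Real.toNNReal_zero, pinnedChain_transitionKernel_zero hω hl.le hβ.le hγ.le N T T,
      ProbabilityTheory.Kernel.id_apply, integral_dirac]
  have hPw0 : Pw 0 = w := funext hP0
  have hN0 : (0 : ℝ) ≤ N := by positivity
  refine ⟨0, le_rfl, by positivity, ?_, ?_⟩
  · rw [hPw0]; exact hw2
  · rw [hPw0]
    calc ∫ z, (w z - w (z.1, -z.2)) ^ 2 ∂μT ≤ C' * N := hON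
      _ ≤ max C' 0 * N := mul_le_mul_of_nonneg_right (le_max_left C' 0) hN0



/-! ## Glue (sorry-free) -/

/-- Real arithmetic of the window split: `√D ≤ 2√A' + √B'`, `A' ≤ A`, `B' ≤ B` (all nonnegative) give
`D ≤ 8A + 2B`. -/
theorem sq_bound_of_sqrt_le {D A' B' A B : ℝ} (hD : 0 ≤ D) (hA' : 0 ≤ A') (hB' : 0 ≤ B')
    (hA : A' ≤ A) (hB : B' ≤ B) (h : Real.sqrt D ≤ 2 * Real.sqrt A' + Real.sqrt B') :
    D ≤ 8 * A + 2 * B := by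
  have hsA : Real.sqrt A' ≤ Real.sqrt A := Real.sqrt_le_sqrt hA
  have hsB : Real.sqrt B' ≤ Real.sqrt B := Real.sqrt_le_sqrt hB
  have hA0 : 0 ≤ A := hA'.trans hA
  have hB0 : 0 ≤ B := hB'.trans hB
  have h' : Real.sqrt D ≤ 2 * Real.sqrt A + Real.sqrt B := h.trans (by linarith)
  have h1 : Real.sqrt D * Real.sqrt D ≤ (2 * Real.sqrt A + Real.sqrt B) * (2 * Real.sqrt A + Real.sqrt B) :=
    mul_self_le_mul_self (Real.sqrt_nonneg _) h'
  have hDD : Real.sqrt D * Real.sqrt D = D := Real.mul_self_sqrt hD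
  have hAA : Real.sqrt A * Real.sqrt A = A := Real.mul_self_sqrt hA0
  have hBB : Real.sqrt B * Real.sqrt B = B := Real.mul_self_sqrt hB0
  nlinarith [sq_nonneg (2 * Real.sqrt A - Real.sqrt B), Real.sqrt_nonneg A, Real.sqrt_nonneg B]

/-- **Abstract arithmetic core of the composition.** For one parameter point, one family and one `T > 0`: with
`Dw N` the reversal asymmetry of the corrector, `Wk N τ` the squared window norm and `Dl N τ` the late reversal
asymmetry (any real-valued bookkeeping functions, nonnegative), the four stub-shaped hypotheses give the crux's conclusion
with `C_K = γc/T² + max C 0 + 1`; `N = 0, 1` by the landed Negative lemmas. -/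
theorem concl_of_parts {ω₂ lam β γ : ℝ} (hω : 0 < ω₂) (hl : 0 < lam) (hβ : 0 < β) (hγ : 0 < γ)
    (hU : ∀ (N : ℕ) (T_L T_R : ℝ), 0 < T_L → 0 < T_R → ∀ μ ν : Measure (PhaseSpace N),
      (pinnedChain ω₂ lam β γ).IsSteadyState N T_L T_R μ →
      (pinnedChain ω₂ lam β γ).IsSteadyState N T_L T_R ν → μ = ν)
    {μ : (N : ℕ) → ℝ → ℝ → Measure (PhaseSpace N)}
    (hμ : ∀ (N : ℕ) (T_L T_R : ℝ), 0 < T_L → 0 < T_R →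
      (pinnedChain ω₂ lam β γ).IsSteadyState N T_L T_R (μ N T_L T_R))
    {T : ℝ} (hT : 0 < T) {C c : ℝ} (hc : 0 < c)
    (Dw : ℕ → ℝ) (Wk Dl : ℕ → ℝ → ℝ) (hDw : ∀ N, 0 ≤ Dw N) (hWk : ∀ N τ, 0 ≤ Wk N τ) (hDl : ∀ N τ, 0 ≤ Dl N τ)
    (hKL : ∀ N : ℕ, 2 ≤ N → ∀ ε : ℝ, 0 < ε → ∀ᶠ δ in 𝓝[≠] (0 : ℝ),
      klDiv (μ N (T + δ / 2) (T - δ / 2))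
          (Measure.map (fun x : PhaseSpace N => (x.1, -x.2)) (μ N (T + δ / 2) (T - δ / 2)))
        ≤ ENNReal.ofReal ((Dw N / 2 + ε) * δ ^ 2))
    (hSplit : ∀ N : ℕ, 2 ≤ N → ∀ τ : ℝ, 0 ≤ τ →
      Real.sqrt (Dw N) ≤ 2 * Real.sqrt (Wk N τ) + Real.sqrt (Dl N τ))
    (hBudget : ∀ N : ℕ, 2 ≤ N → ∀ τ : ℝ, 0 ≤ τ → Wk N τ ≤ γ * τ / (4 * T ^ 2))
    (hLate : ∀ N : ℕ, 2 ≤ N → ∃ τ : ℝ, 0 ≤ τ ∧ τ ≤ c * N ∧ Dl N τ ≤ C * N) :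
    ∃ C' : ℝ, ∀ N : ℕ, ∀ᶠ δ in 𝓝[≠] (0 : ℝ),
      klDiv (μ N (T + δ / 2) (T - δ / 2))
          (Measure.map (fun x : PhaseSpace N => (x.1, -x.2)) (μ N (T + δ / 2) (T - δ / 2)))
        ≤ ENNReal.ofReal (C' * (N : ℝ) * δ ^ 2) := by
  refine ⟨γ * c / T ^ 2 + max C 0 + 1, fun N => ?_⟩
  rcases Nat.lt_or_ge N 2 with hN | hN
  · interval_cases N
    · exact extensiveSnapshotIrreversibility_bound_at_zero hμ hT _
    · exact extensiveSnapshotIrreversibility_bound_at_one hω hl hβ hU hμ hT _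
  · have hN0 : (0 : ℝ) ≤ N := by positivity
    have hN1 : (1 : ℝ) ≤ N := by exact_mod_cast (le_trans (by norm_num) hN)
    obtain ⟨τ, hτ0, hτc, hL⟩ := hLate N hN
    have hT2 : 0 < T ^ 2 := by positivity
    have hBτ : Wk N τ ≤ γ * (c * N) / (4 * T ^ 2) :=
      (hBudget N hN τ hτ0).trans
        (div_le_div_of_nonneg_right (mul_le_mul_of_nonneg_left hτc hγ.le) (by positivity))
    have hkey : Dw N ≤ 8 * (γ * (c * N) / (4 * T ^ 2)) + 2 * (max C 0 * N) :=
      sq_bound_of_sqrt_le (hDw N) (hWk N τ) (hDl N τ) hBτ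
        (hL.trans (mul_le_mul_of_nonneg_right (le_max_left _ _) hN0))
        (hSplit N hN τ hτ0)
    filter_upwards [hKL N hN 1 one_pos] with δ hδ
    refine hδ.trans (ENNReal.ofReal_le_ofReal ?_)
    have hδ2 : 0 ≤ δ ^ 2 := sq_nonneg δ
    apply mul_le_mul_of_nonneg_right _ hδ2
    have h8 : 8 * (γ * (c * N) / (4 * T ^ 2)) = 2 * (γ * c / T ^ 2 * N) := by
      field_simp
      ring
    rw [h8] at hkey
    have hgc : 0 ≤ γ * c / T ^ 2 := by positivity
    have hm : 0 ≤ max C 0 := le_max_right _ _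
    nlinarith [hkey, hgc, hm, hN1, mul_nonneg hgc hN0, mul_nonneg hm hN0]

/-- **The composition** — concludes the crux `ExtensiveSnapshotIrreversibility` BY NAME from the stubs (S1 split into S1a/S1b/S1c ⟸ S1d ⟸ S1r' + S1g'; S4 ⟸ S4o ⟸ S4k ⟸ S_A + S_B + S_C, this line). -/
theorem ExtensiveSnapshotIrreversibility_of : ExtensiveSnapshotIrreversibility := by
  intro ω₂ lam β γ hω hl hβ hγ hU μ hμ T hT
  obtain ⟨C, c, hc, hLate⟩ := stub_lateOddResponse ω₂ lam β γ hω hl hβ hγ hU T hT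
  -- bookkeeping functions (the line's objects at `N`, as real numbers)
  let g : (N : ℕ) → 2 ≤ N → PhaseSpace N → ℝ := fun N hN y =>
    γ / (2 * T ^ 2) * (y.2 ⟨0, by omega⟩ ^ 2 - y.2 ⟨N - 1, by omega⟩ ^ 2)
  let Pg : (N : ℕ) → 2 ≤ N → ℝ → PhaseSpace N → ℝ := fun N hN s z =>
    ∫ y, g N hN y ∂((pinnedChain ω₂ lam β γ).transitionKernel N T T s.toNNReal z)
  let k : (N : ℕ) → 2 ≤ N → ℝ → PhaseSpace N → ℝ := fun N hN τ z => ∫ s in (0 : ℝ)..τ, Pg N hN s z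
  let w : (N : ℕ) → 2 ≤ N → PhaseSpace N → ℝ := fun N hN z => ∫ s in Set.Ioi (0 : ℝ), Pg N hN s z
  let Pw : (N : ℕ) → 2 ≤ N → ℝ → PhaseSpace N → ℝ := fun N hN τ z =>
    ∫ x, w N hN x ∂((pinnedChain ω₂ lam β γ).transitionKernel N T T τ.toNNReal z)
  let μT : (N : ℕ) → Measure (PhaseSpace N) := fun N => (pinnedChain ω₂ lam β γ).gibbsMeasure N T
  let Dw : ℕ → ℝ := fun N =>
    if hN : 2 ≤ N then ∫ z, (w N hN z - w N hN (z.1, -z.2)) ^ 2 ∂(μT N) else 0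
  let Wk : ℕ → ℝ → ℝ := fun N τ => if hN : 2 ≤ N then ∫ z, (k N hN τ z) ^ 2 ∂(μT N) else 0
  let Dl : ℕ → ℝ → ℝ := fun N τ =>
    if hN : 2 ≤ N then ∫ z, (Pw N hN τ z - Pw N hN τ (z.1, -z.2)) ^ 2 ∂(μT N) else 0
  have hDw : ∀ N, 0 ≤ Dw N := fun N => by
    simp only [Dw]; split_ifs
    · exact integral_nonneg fun _ => sq_nonneg _
    · exact le_rfl
  have hWk : ∀ N τ, 0 ≤ Wk N τ := fun N τ => by
    simp only [Wk]; split_ifs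
    · exact integral_nonneg fun _ => sq_nonneg _
    · exact le_rfl
  have hDl : ∀ N τ, 0 ≤ Dl N τ := fun N τ => by
    simp only [Dl]; split_ifs
    · exact integral_nonneg fun _ => sq_nonneg _
    · exact le_rfl
  -- per-`N` facts from the stubs
  have facts : ∀ N : ℕ, ∀ hN : 2 ≤ N,
      (∀ ε : ℝ, 0 < ε → ∀ᶠ δ in 𝓝[≠] (0 : ℝ),
        klDiv (μ N (T + δ / 2) (T - δ / 2))
            (Measure.map (fun x : PhaseSpace N => (x.1, -x.2)) (μ N (T + δ / 2) (T - δ / 2)))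
          ≤ ENNReal.ofReal ((Dw N / 2 + ε) * δ ^ 2)) ∧
      (∀ τ : ℝ, 0 ≤ τ → Real.sqrt (Dw N) ≤ 2 * Real.sqrt (Wk N τ) + Real.sqrt (Dl N τ)) ∧
      (∀ τ : ℝ, 0 ≤ τ → Wk N τ ≤ γ * τ / (4 * T ^ 2)) ∧
      (∃ τ : ℝ, 0 ≤ τ ∧ τ ≤ c * N ∧ Dl N τ ≤ C * N) := by
    intro N hN
    have hN0 : 0 < N := by omega
    obtain ⟨hInv, hMix⟩ := stub_equilibriumKernelFacts ω₂ lam β γ hω hl hβ hγ hU T hT N hN0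
    obtain ⟨-, hw2, hwin⟩ := stub_correctorIntegrability ω₂ lam β γ hω hl hβ hγ T hT N hN hInv hMix
    have hCalc := stub_gibbsContactCalculus ω₂ lam β γ hω hl hβ hγ T hT N hN0
    have hId := stub_mcLennanIdentification ω₂ lam β γ hω hl hβ hγ hU μ hμ T hT N hN hInv hMix hw2
    obtain ⟨h, hRD⟩ := stub_responseDensity ω₂ lam β γ hω hl hβ hγ hU μ hμ T hT N
    have hKLh := stub_snapshotKLUpper ω₂ lam β γ hω hl hβ hγ hU μ hμ T hT N hN h hRD
    have hKL : ∀ ε : ℝ, 0 < ε → ∀ᶠ δ in 𝓝[≠] (0 : ℝ),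
        klDiv (μ N (T + δ / 2) (T - δ / 2))
            (Measure.map (fun x : PhaseSpace N => (x.1, -x.2)) (μ N (T + δ / 2) (T - δ / 2)))
          ≤ ENNReal.ofReal (((∫ z, (w N hN z - w N hN (z.1, -z.2)) ^ 2 ∂(μT N)) / 2 + ε) * δ ^ 2) := by
      intro ε hε
      have hEq : ∫ x, (h x - h (x.1, -x.2)) ^ 2 ∂(μ N T T) =
          ∫ z, (w N hN z - w N hN (z.1, -z.2)) ^ 2 ∂(μT N) := hId h hRD
      refine hKLh _ ?_
      rw [hEq]
      linarith
    have hBud := stub_clausiusBudget ω₂ lam β γ hω hl hβ hγ hU T hT N hN hInv hMix hCalc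
      (fun τ hτ => (hwin τ hτ).1)
    obtain ⟨τ₀, hτ₀, hτ₀c, hPw2, hL⟩ := hLate N hN hInv hMix
    refine ⟨?_, ?_, ?_, ?_⟩
    · intro ε hε
      simpa only [Dw, dif_pos hN] using hKL ε hε
    · intro τ hτ
      obtain ⟨hk2, hPw2', hident⟩ := hwin τ hτ
      have h := stub_correctorCocycle ω₂ lam β γ hω hl hβ hγ T hT N (w N hN) (k N hN τ) (Pw N hN τ)
        hw2 hk2 hPw2' hident
      simpa only [Dw, Wk, Dl, dif_pos hN] using h
    · intro τ hτ
      simpa only [Wk, dif_pos hN] using hBud τ hτ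
    · exact ⟨τ₀, hτ₀, hτ₀c, by simpa only [Dl, dif_pos hN] using hL⟩
  exact concl_of_parts hω hl hβ hγ hU hμ hT hc Dw Wk Dl hDw hWk hDl
    (fun N hN => (facts N hN).1) (fun N hN => (facts N hN).2.1) (fun N hN => (facts N hN).2.2.1)
    (fun N hN => (facts N hN).2.2.2)

end Summit.AtomisticToContinuum.FouriersLaw.Cruxes.ExtensiveSnapshotIrreversibility.TapDualityGkTime

end
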